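import Mathlib
import HarnessLib
import Summits.ResolutionOfSingularities.ResolutionOfSingularities.Theorems.WildQuotientsWildQuotientResolutionS1aCuspPointsFamily
import Summits.ResolutionOfSingularities.ResolutionOfSingularities.Theorems.WildQuotientsWildQuotientResolutionS1aCuspPointFacts
import Summits.ResolutionOfSingularities.ResolutionOfSingularities.Theorems.WildQuotientsWildQuotientResolutionS1aCuspRingDataFamily
import Summits.ResolutionOfSingularities.ResolutionOfSingularities.Theorems.WildQuotientsWildQuotientResolutionS1aCuspMemberOXiUnits
import Summits.ResolutionOfSingularities.ResolutionOfSingularities.Theorems.WildQuotientsWildQuotientResolutionS1aCuspMemberQUnits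
import Summits.ResolutionOfSingularities.ResolutionOfSingularities.Theorems.WildQuotientsWildQuotientResolutionS1aCuspMemberQvUnits
import Summits.ResolutionOfSingularities.ResolutionOfSingularities.Theorems.WildQuotientsWildQuotientResolutionS1aMovePullbackNeZero
import Summits.ResolutionOfSingularities.ResolutionOfSingularities.Theorems.WildQuotientsWildQuotientResolutionS1aChartPinTransport
import Summits.ResolutionOfSingularities.ResolutionOfSingularities.Theorems.WildQuotientsWildQuotientResolutionS1aResidualSectionPins
import Summits.ResolutionOfSingularities.ResolutionOfSingularities.Theorems.WildQuotientsWildQuotientResolutionS1aCuspResidualOPoint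
import Summits.ResolutionOfSingularities.ResolutionOfSingularities.Theorems.WildQuotientsWildQuotientResolutionS1aCuspResidualQPoint
import Summits.ResolutionOfSingularities.ResolutionOfSingularities.Theorems.WildQuotientsWildQuotientResolutionS1aCuspResidualOTransition
import Summits.ResolutionOfSingularities.ResolutionOfSingularities.Theorems.WildQuotientsWildQuotientResolutionS1aSectionGlueKillAssoc
import Summits.ResolutionOfSingularities.ResolutionOfSingularities.Theorems.WildQuotientsWildQuotientResolutionS1aCuspKillThree
import Summits.ResolutionOfSingularities.ResolutionOfSingularities.Theorems.WildQuotientsWildQuotientResolutionS1aCrossPointPin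
import Summits.ResolutionOfSingularities.ResolutionOfSingularities.Theorems.WildQuotientsWildQuotientResolutionS1aGraphTailKillsIn
import Summits.ResolutionOfSingularities.ResolutionOfSingularities.Theorems.WildQuotientsWildQuotientResolutionS1aQhTailSection
import Summits.ResolutionOfSingularities.ResolutionOfSingularities.Theorems.WildQuotientsWildQuotientResolutionS1aCuspFLocus

/-!
# S1a — ★★★ R4c `cusp_killsIn_two`: the census CUSP `x₁ ↦ x₁ + x₀, x₂ ↦ x₂ + x₀, x₃ ↦ x₃ + (x₂² − x₁³)` is a TWO-SHOT kill

[OURS · L1 W4.5c · crux stmt-ResolutionOfSingularities-17941 `CyclicQuotientFourfolds`, line `s1a-logminvertex` v13 (research stub `stub_reachLowerInFX`),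
R4c row of the line's master tree; SPEC `Cruxes/CyclicQuotientFourfolds/Lines/s1a_logminvertex-R4c-SPEC.md`, recipe `…-R4c-PROGRESS-b3Q.md` ADDENDUM 2,
obligations `…-R4c-PROGRESS-v2.md`; skeleton v1 leafhand-res-wildquotients-1 g0, v2 -2 g0 (crux dir `Lines/s1a_logminvertex_CuspKillsIn_skeleton.lean`),
v3 -7 g1 (evidence), closed by -7 g2] — NOT a statement of the manuscript; counted 0; AI-level work, weaker than expert review.

`KillsIn 2` for the initial model of the cusp normal form (`(2 : k) ≠ 0`, `(3 : k) ≠ 0`). MOVE 1 = the glued two-point root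
(✓`exists_cusp_pointCentre`, ✓`Cusp.cusp_pointFacts`, ✓`Cusp.cusp_ringData`, disjoint supports, ✓`MultiRoot.isAdmissibleCentre_infRees_of_disjoint`,
✓`exists_moveAtlas_of_nodes` with the two residual sections `u₀′^{n₀}/c`, `t̂ⁿ/c` per producer chart). MOVE 2 = ONE glued principal centre read on the
three section-presented MEMBER CHARTS `U_O ⊂ O′₀₁` (✓`exists_cuspO_memberChart_rel_xi_units`), `U_{Q,1} ⊂ O′₁₁` (✓`exists_cuspQ_memberChart_rel_units`),
`U_{Q,2} ⊂ O′₁₂` (✓`exists_cuspQv_memberChart_rel_units`), all normalised by the SAME global function `ξ_O = 2x₂ − 3x₁²` (`a·(π^*ξ_O)³ = π^*x₀`,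
`bb·(π^*ξ_O)² = π^*f`), and killed by the first-order three-chart lemma ✓`killsIn_one_of_threeCharts_global` (p823439): `hζ : π^*ξ_O ≠ 0`
(✓`GModel.appLE_top_ne_zero_of_eq_comp_id`); COVER = `hcovX`/`hcovM` + the residual placement (C1) (✓`KillCert.QhSym.cuspO_mem_basicOpen_of_residual`,
✓`KillCert.QhAway.cuspQ/Qv_mem_basicOpen_of_residual`, chart `O′₀₂` through ✓`cuspO_mem_basicOpen_transition_of_residual` +
✓`mem_blowupChart_of_mem_basicOpen_of_mul_appLE_eq`); UNITS = the members' `_units` export (same chart), the scheme pins of the residual sections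
(✓`QhAbs.qha_residualSection_zero_pin` / `_tail_pin` + ✓`symm_mul_appLE_eq_of_pin`) transported by ✓`mem_basicOpen_iff_of_pins` (same point) and made
invertible downstairs off the other point's support (✓`mem_basicOpen_appLE_top_of_pin_pow_of_not_mem_support`, p823768; cross point);
F-LOCUS = the move atlas leaves only residual points.
* ★★★ `GameFrame.GModel.cusp_killsIn_two`.
-/

set_option linter.dupNamespace false

noncomputable section

open CategoryTheory Limits AlgebraicGeometry TopologicalSpace Topology Opposite MvPolynomial
open Literature.AlgebraicGeometry.Resolution Literature.AlgebraicGeometry.RelativeSpec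
open scoped LaurentPolynomial
open Summit.ResolutionOfSingularities.ResolutionOfSingularities.Theorems.WildQuotientResolution.S1 Summit.ResolutionOfSingularities.ResolutionOfSingularities.Theorems.WildQuotientResolution.S1.NodeAtlas Summit.ResolutionOfSingularities.ResolutionOfSingularities.Theorems.WildQuotientResolution.S1.CoarseChart Summit.ResolutionOfSingularities.ResolutionOfSingularities.Theorems.WildQuotientResolution.S1.ProducerStep
open Summit.ResolutionOfSingularities.ResolutionOfSingularities.Theorems.WildQuotientResolution.S1.NpFrame Summit.ResolutionOfSingularities.ResolutionOfSingularities.Theorems.WildQuotientResolution.S1.GoodCharts Summit.ResolutionOfSingularities.ResolutionOfSingularities.Theorems.WildQuotientResolution.S1.BlowupCharts Summit.ResolutionOfSingularities.ResolutionOfSingularities.Theorems.WildQuotientResolution.S1.KillableTransport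
open Summit.ResolutionOfSingularities.ResolutionOfSingularities.Theorems.WildQuotientResolution.S1.KillCert Summit.ResolutionOfSingularities.ResolutionOfSingularities.Theorems.WildQuotientResolution.S1.ReesBigrading Summit.ResolutionOfSingularities.ResolutionOfSingularities.Theorems.WildQuotientResolution.S1.NodeTransport Summit.ResolutionOfSingularities.ResolutionOfSingularities.Theorems.WildQuotientResolution.S1.CobordantTransport
open Summit.ResolutionOfSingularities.ResolutionOfSingularities.Theorems.WildQuotientResolution.BlowupExit Summit.ResolutionOfSingularities.ResolutionOfSingularities.Theorems.WildQuotientResolution.S1.KillGlue Summit.ResolutionOfSingularities.ResolutionOfSingularities.Theorems.WildQuotientResolution.S1.CentreGluing Summit.ResolutionOfSingularities.ResolutionOfSingularities.Theorems.WildQuotientResolution.S1.FreeModel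
open Summit.ResolutionOfSingularities.ResolutionOfSingularities.Theorems.WildQuotientResolution.S1.ModelNode Summit.ResolutionOfSingularities.ResolutionOfSingularities.Theorems.WildQuotientResolution.S1.NodeAway Summit.ResolutionOfSingularities.ResolutionOfSingularities.Theorems.WildQuotientResolution.S1.NodeChartAway Summit.ResolutionOfSingularities.ResolutionOfSingularities.Theorems.WildQuotientResolution.S1.CentreAway

namespace Summit.ResolutionOfSingularities.ResolutionOfSingularities.Theorems.WildQuotientResolution.S1.GameFrame.GModel

open Summit.ResolutionOfSingularities.ResolutionOfSingularities.Theorems.WildQuotientResolution.S1.GameFrame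
open Summit.ResolutionOfSingularities.ResolutionOfSingularities.Theorems.WildQuotientResolution.S1.GameFrame.GModel

variable {p : ℕ} {X' X₁ : Scheme.{0}} {q : X' ⟶ X₁} {G : Type} [Group G] {ρ : G →* Aut X'} {g₀ : G}

set_option maxHeartbeats 16000000 in
set_option synthInstance.maxHeartbeats 400000 in
/-- ★★★ **`KillsIn 2` FOR THE INITIAL MODEL OF THE CENSUS CUSP** `σ : x₁ ↦ x₁ + x₀, x₂ ↦ x₂ + x₀, x₃ ↦ x₃ + (x₂² − x₁³)` over a field with
`2 ≠ 0`, `3 ≠ 0`: two moves — the glued two-point weighted root at `O = (0,0)` and the tangency point `Q = (4/9, 8/27)` of the cusp, then ONE glued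
principal centre presented by sections on the three member charts — kill every node. See the module docstring for the assembly.
[OURS · L1 W4.5c · R4c; NOT a statement of the manuscript] -/
theorem cusp_killsIn_two [Finite G] (hp : p.Prime) (hG : ∀ g : G, g ∈ Subgroup.zpowers g₀) (hg₀ : g₀ ^ p = 1) (hq : ∀ g : G, (ρ g).hom ≫ q = q) [IsIntegral X'] [IsLocallyNoetherian X'] [X'.IsSeparated] [IsAffine X'] {k' : Type} [Field k'] (φ : X₁ ⟶ Spec (.of k')) [IsSeparated φ] [LocallyOfFiniteType φ] [IsFinite q] {k : Type} [Field k] [Fact p.Prime] [CharP k p] (hk2 : (2 : k) ≠ 0) (hk3 : (3 : k) ≠ 0) (σ : (MvPolynomial (Fin 4) k) ≃+* (MvPolynomial (Fin 4) k)) (hC : ∀ a : k, σ (C a) = C a) (h0 : σ (X 0) = X 0) (h1 : σ (X 1) = X 1 + X 0) (h2 : σ (X 2) = X 2 + X 0) (h3 : σ (X 3) = X 3 + (X 2 ^ 2 - X 1 ^ 3)) (e : Γ(X', ⊤) ≃+* (MvPolynomial (Fin 4) k)) (hστ : ∀ t : Γ(X', ⊤), e ((ρ g₀⁻¹).hom.appLE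 ⊤ ⊤ (by rw [Scheme.Hom.preimage_top]) t) = σ (e t)) (h₀ : NodeAtlas p (⟨ρ, hq⟩ : ActionOver q G) g₀) : KillsIn 2 (GModel.initial (p := p) (g₀ := g₀) hq h₀) := by
  classical
  haveI : NeZero p := ⟨hp.ne_zero⟩; have hp1 : p ≠ 1 := hp.one_lt.ne'; obtain ⟨a, ha9⟩ : ∃ a : k, a * 9 = 4 := ⟨4 / 9, by
    have h9 : (9 : k) ≠ 0 := by rw [show (9 : k) = 3 ^ 2 by norm_num]; exact pow_ne_zero 2 hk3
    field_simp⟩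
  obtain ⟨c, hc27⟩ : ∃ c : k, c * 27 = 8 := ⟨8 / 27, by
    have h27 : (27 : k) ≠ 0 := by rw [show (27 : k) = 3 ^ 3 by norm_num]; exact pow_ne_zero 3 hk3
    field_simp⟩
  have ha : a ≠ 0 := by
    rintro rfl; rw [zero_mul] at ha9; exact (show (4 : k) ≠ 0 by rw [show (4 : k) = 2 ^ 2 by norm_num]; exact pow_ne_zero 2 hk2) ha9.symm
  have hc0 : c ≠ 0 := by
    rintro rfl; rw [zero_mul] at hc27; exact (show (8 : k) ≠ 0 by rw [show (8 : k) = 2 ^ 3 by norm_num]; exact pow_ne_zero 3 hk2) hc27.symm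
  have h81 : (81 : k) ≠ 0 := by rw [show (81 : k) = 3 ^ 4 by norm_num]; exact pow_ne_zero 4 hk3
  have h729 : (729 : k) ≠ 0 := by rw [show (729 : k) = 3 ^ 6 by norm_num]; exact pow_ne_zero 6 hk3
  have hQ1 : 2 * c = 3 * a ^ 2 := by
    have h : (2 * c - 3 * a ^ 2) * 81 = 0 := by linear_combination (6 : k) * hc27 - (27 * a + 12) * ha9
    rcases mul_eq_zero.mp h with h | h
    · exact sub_eq_zero.mp h
    · exact absurd h h81
  have hQ2 : c ^ 2 = a ^ 3 := by
    have h : (c ^ 2 - a ^ 3) * 729 = 0 := by linear_combination (c * 27 + 8) * hc27 - ((a * 9) ^ 2 + 4 * (a * 9) + 16) * ha9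
    rcases mul_eq_zero.mp h with h | h
    · exact sub_eq_zero.mp h
    · exact absurd h h729
  have he0 : (2 : k) * (1 - 3 * a) ≠ 0 := by
    intro h; have h' : (2 * (1 - 3 * a)) * 3 = (-2 : k) := by linear_combination (-2 : k) * ha9
    rw [h, zero_mul] at h'; exact hk2 (by linear_combination h')
  haveI : IsAffine (⊤ : X'.Opens) := isAffineOpen_top X'; have hAff : IsAffineHom ((⊤ : X'.Opens).ι ≫ q) := inferInstance; have hst : ∀ g : G, (ρ g).hom ⁻¹ᵁ (⊤ : X'.Opens) = ⊤ := fun g => Scheme.Hom.preimage_top _; let O : (GModel.initial (p := p) (g₀ := g₀) hq h₀).act.StableAffineOpens := ⟨⊤, hst, hAff⟩; have hO : IsAffineOpen O.1 := isAffineOpen_top X'; have hOuniv : ∀ u : (GModel.initial (p := p) (g₀ := g₀) hq h₀).V, u ∈ O.1 := fun _ => Set.mem_univ _; haveI hsep₀ : (GModel.initial (p := p) (g₀ := g₀) hq h₀).V.IsSeparated := ‹X'.IsSeparated›; obtain ⟨e₀, he₀⟩ : ∃ e₀ : Γ((GModel.initial (p := p) (g₀ := g₀) hq h₀).V, O.1)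 ≃+* (MvPolynomial (Fin 4) k), ∀ t, e₀ t = e t := ⟨e, fun _ => rfl⟩; have hact : ∀ t : Γ((GModel.initial (p := p) (g₀ := g₀) hq h₀).V, O.1), actOEquiv (GModel.initial (p := p) (g₀ := g₀) hq h₀).act O g₀ t = e₀.symm (σ (e₀ t)) := fun t => e₀.injective (by rw [e₀.apply_symm_apply, he₀, he₀, ← hστ]; rfl)
  have hσp : ∀ a : (MvPolynomial (Fin 4) k), (⇑σ)^[p] a = a := iterate_eq_self_of_chart (GModel.initial (p := p) (g₀ := g₀) hq h₀) O hg₀ e₀ σ hact; have hcl : ∀ S : Set Γ((GModel.initial (p := p) (g₀ := g₀) hq h₀).V, O.1), IsClosed ((GModel.initial (p := p) (g₀ := g₀) hq h₀).V.zeroLocus (U := O.1) S ∩ (O.1 : Set (GModel.initial (p := p) (g₀ := g₀) hq h₀).V)) := fun S => ((GModel.initial (p := p) (g₀ := g₀) hq h₀).V.zeroLocus_isClosed _).inter (by exact isClosed_univ)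
  have hpt := fun i => exists_cusp_pointCentre hG (GModel.initial (p := p) (g₀ := g₀) hq h₀) O hO e₀ σ hC h0 h1 h2 h3 hact hσp hcl a c ha hQ1 hQ2 i; choose hh hhh γ eI σI hσh hactI hrest using hpt; have heI : ∀ i t, eI i t = γ i (e₀ t) := fun i => (hrest i).1; have hγs0 : ∀ i, (γ i).symm (X 0) = X 0 := fun i => (hrest i).2.1.2.2.2.2.1; have hγs1 : ∀ i, (γ i).symm (X 1) = X 1 - C ((![(0 : k), a] : Fin 2 → k) i) := fun i => (hrest i).2.1.2.2.2.2.2.1; have hCI : ∀ i (a : k), σI i (C a) = C a := fun i => (hrest i).2.2.1.1; have h0I : ∀ i, σI i (X 0) = X 0 := fun i => (hrest i).2.2.1.2.1; have h1I : ∀ i, σI i (X 1) = X 1 + X 0 := fun i => (hrest i).2.2.1.2.2.1; have h2I : ∀ i, σI i (X 2) = (![X 2 + X 0, X 2] : Fin 2 → (MvPolynomial (Fin 4) k)) i := fun i => (hrest i).2.2.1.2.2.2.1; have h3I : ∀ i, σI i (X 3) = X 3 + ((![(X 2 ^ 2 - X 1 ^ 3 : MvPolynomial (Fin 4) k), (X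 2 ^ 2 + 2 * X 1 * X 2 + C (2 * c) * X 2 + C (1 - 3 * a) * X 1 ^ 2 - X 1 ^ 3 : MvPolynomial (Fin 4) k)] : Fin 2 → (MvPolynomial (Fin 4) k)) i) := fun i => (hrest i).2.2.1.2.2.2.2.1; have hσpI : ∀ i (a : (MvPolynomial (Fin 4) k)), (⇑(σI i))^[p] a = a := fun i => (hrest i).2.2.1.2.2.2.2.2; have hnode := fun i => (hrest i).2.2.2; choose 𝒜u gr eW hfull htame hσW hpinW hKex using hnode; choose 𝒦 dI hdI hadm hchart hG𝒦 hfil hver hsupp using hKex; letI : ∀ i, GradedRing (𝒜u i) := gr; have hW1 : ∀ i, (basicOpenStable (GModel.initial (p := p) (g₀ := g₀) hq h₀).act O hO (actO_symm_eq_of_fixed hG (GModel.initial (p := p) (g₀ := g₀) hq h₀) O (eI i) (σI i) (hactI i) (hh i) (hσh i))).1 = (GModel.initial (p := p) (g₀ := g₀) hq h₀).V.basicOpen ((eI i).symm (hh i)) := fun i => rfl; have hWaff : ∀ i, IsAffineOpen (basicOpenStable (GModel.initial (p := p) (g₀ := g₀) hq h₀).act O hO (actO_symm_eq_of_fixed hG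 (GModel.initial (p := p) (g₀ := g₀) hq h₀) O (eI i) (σI i) (hactI i) (hh i) (hσh i))).1 := fun i => hO.basicOpen _; have heIs : ∀ i (f : (MvPolynomial (Fin 4) k)), (eI i).symm f = e₀.symm ((γ i).symm f) := fun i f => (eI i).injective (by rw [(eI i).apply_symm_apply, heI, e₀.apply_symm_apply]; exact ((γ i).apply_symm_apply f).symm)
  have hfA : ∀ i (l : Fin 3), (fun l => algebraMap (MvPolynomial (Fin 4) k) (Localization.Away (hh i)) (X ((![0, 1, 2] : Fin 3 → Fin 4) l))) l ∈ 𝒜u i ((fun _ => (0 : (Π j : Fin 0, ZMod ((![] : Fin 0 → ℕ) j)))) l) := fun i l => hfull i _ _; have hfull0 : ∀ i (x : (Localization.Away (hh i))), x ∈ 𝒜u i 0 := fun i x => hfull i _ _; have hw : ∀ i (l : Fin 3), 0 < ((![(![9, 2, 3] : Fin 3 → ℕ), (![3, 1, 2] : Fin 3 → ℕ)] : Fin 2 → (Fin 3 → ℕ)) i) l := fun i l => by fin_cases i <;> fin_cases l <;> decide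
  have hfacts := fun i => Cusp.cusp_pointFacts hp.pos a c (σI i) (hCI i) (h0I i) (h1I i) i (h2I i) (h3I i) (hh i) (hσh i) (hσpI i); choose ht hσJ H1 hres0 hrest1 using hfacts; have hσpL : ∀ i (y : (Localization.Away (hh i))), (⇑(sigmaAway (σI i) (hσh i)))^[p] y = y := fun i y => KillCert.QhAway.qhl_iterate (σI i) (hh i) (hσh i) (hσpI i) y; have hα : Function.Injective (![(0 : k), a] : Fin 2 → k) := injective_zero_pair ha; have hne : ∀ i, ∀ j ∈ Finset.univ.erase i, (![(0 : k), a] : Fin 2 → k) i - (![(0 : k), a] : Fin 2 → k) j ≠ 0 := fun i j hj h => Finset.ne_of_mem_erase hj (hα (sub_eq_zero.mp h)).symm; have hh0ev : ∀ i, MvPolynomial.eval (fun _ : Fin 4 => (0 : k)) (hh i) ≠ 0 := fun i => hhh i ▸ GraphTail.eval_locPoly_ne_zero _ _ (hne i) _ rfl rfl; have hh0 : ∀ i, hh i ≠ 0 := fun i h => hh0ev i (by rw [h, map_zero])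
  have hK1 : ∀ i, RingTheory.Sequence.IsRegular (Localization.Away (hh i)) (List.ofFn (fun l => algebraMap (MvPolynomial (Fin 4) k) (Localization.Away (hh i)) (X ((![0, 1, 2] : Fin 3 → Fin 4) l)))) := fun i => KillCert.QhAway.qhl_isRegular (hh i) (fun _ => (0 : k)) rfl rfl rfl (hh0ev i); have hK1' : ∀ i, IsRegularRing ((Localization.Away (hh i)) ⧸ Ideal.span (Set.range (fun l => algebraMap (MvPolynomial (Fin 4) k) (Localization.Away (hh i)) (X ((![0, 1, 2] : Fin 3 → Fin 4) l))))) := fun i => KillCert.QhAway.qhl_isRegularRing_quotient (hh i); obtain ⟨D, hDdef⟩ : ∃ D : ℕ, D = ∏ i, dI i := ⟨_, rfl⟩; have hDmul : ∀ i, dI i * ∏ j ∈ Finset.univ.erase i, dI j = D := fun i => hDdef ▸ Finset.mul_prod_erase Finset.univ dI (Finset.mem_univ i); have hlpos : ∀ i, 0 < ∏ j ∈ Finset.univ.erase i, dI j := fun i => Finset.prod_pos fun j _ => hdI j; have hD : 0 < D := by rw [hDdef]; exact Finset.prod_pos fun j _ => hdI j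
  have hadmD : ∀ i, IsAdmissibleCentre p (GModel.initial (p := p) (g₀ := g₀) hq h₀).act g₀ (𝒦 i) D := fun i => hDmul i ▸ isAdmissibleCentre_mul (hadm i) (hlpos i); have hverD : ∀ i, VeroneseNormalised (𝒜u i) (fun l => algebraMap (MvPolynomial (Fin 4) k) (Localization.Away (hh i)) (X ((![0, 1, 2] : Fin 3 → Fin 4) l))) ((![(![9, 2, 3] : Fin 3 → ℕ), (![3, 1, 2] : Fin 3 → ℕ)] : Fin 2 → (Fin 3 → ℕ)) i) D := fun i => hDmul i ▸ CoarseChart.veroneseNormalised_mul _ _ _ (hver i) (hlpos i); have hsuppD : ∀ i, ((((𝒦 i).ideal D).support : Set (GModel.initial (p := p) (g₀ := g₀) hq h₀).V)) ⊆ ((basicOpenStable (GModel.initial (p := p) (g₀ := g₀) hq h₀).act O hO (actO_symm_eq_of_fixed hG (GModel.initial (p := p) (g₀ := g₀) hq h₀) O (eI i) (σI i) (hactI i) (hh i) (hσh i))).1 : Set (GModel.initial (p := p) (g₀ := g₀) hq h₀).V) := fun i => support_ideal_eq_of_pos (𝒦 i) hD (hdI i) ▸ hsupp i; have hBsub : ∀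 i, ∀ v ∈ ((((𝒦 i).ideal D).support : Set (GModel.initial (p := p) (g₀ := g₀) hq h₀).V)), v ∉ (GModel.initial (p := p) (g₀ := g₀) hq h₀).V.basicOpen ((eI i).symm (X 1)) := by
    intro i v hv hvB; have hvW : v ∈ (basicOpenStable (GModel.initial (p := p) (g₀ := g₀) hq h₀).act O hO (actO_symm_eq_of_fixed hG (GModel.initial (p := p) (g₀ := g₀) hq h₀) O (eI i) (σI i) (hactI i) (hh i) (hσh i))).1 := hsuppD i hv; have hs1 : algebraMap Γ((GModel.initial (p := p) (g₀ := g₀) hq h₀).V, O.1) Γ((GModel.initial (p := p) (g₀ := g₀) hq h₀).V, (GModel.initial (p := p) (g₀ := g₀) hq h₀).V.basicOpen ((eI i).symm (hh i))) ((eI i).symm (X 1)) ∈ ((𝒦 i).filtration ⟨(basicOpenStable (GModel.initial (p := p) (g₀ := g₀) hq h₀).act O hO (actO_symm_eq_of_fixed hG (GModel.initial (p := p) (g₀ := g₀) hq h₀) O (eI i) (σI i) (hactI i) (hh i) (hσh i))).1, hWaff i⟩).ideal (((![(![9, 2, 3] : Fin 3 → ℕ), (![3, 1, 2] : Fin 3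 → ℕ)] : Fin 2 → (Fin 3 → ℕ)) i) 1) := by
      rw [hfil i (((![(![9, 2, 3] : Fin 3 → ℕ), (![3, 1, 2] : Fin 3 → ℕ)] : Fin 2 → (Fin 3 → ℕ)) i) 1)]; refine Ideal.mem_comap.mpr ?_; change eW i (algebraMap Γ((GModel.initial (p := p) (g₀ := g₀) hq h₀).V, O.1) Γ((GModel.initial (p := p) (g₀ := g₀) hq h₀).V, (GModel.initial (p := p) (g₀ := g₀) hq h₀).V.basicOpen ((eI i).symm (hh i))) ((eI i).symm (X 1))) ∈ (traceFiltration (𝒜u i) (fun l => algebraMap (MvPolynomial (Fin 4) k) (Localization.Away (hh i)) (X ((![0, 1, 2] : Fin 3 → Fin 4) l))) ((![(![9, 2, 3] : Fin 3 → ℕ), (![3, 1, 2] : Fin 3 → ℕ)] : Fin 2 → (Fin 3 → ℕ)) i)).ideal (((![(![9, 2, 3] : Fin 3 → ℕ), (![3, 1, 2] : Fin 3 → ℕ)] : Fin 2 → (Fin 3 → ℕ)) i) 1); rw [mem_traceFiltration_iff, hpinW i, (eI i).apply_symm_apply]; exact mem_weightedFiltration_ideal (fun l => algebraMap (MvPolynomial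 (Fin 4) k) (Localization.Away (hh i)) (X ((![0, 1, 2] : Fin 3 → Fin 4) l))) ((![(![9, 2, 3] : Fin 3 → ℕ), (![3, 1, 2] : Fin 3 → ℕ)] : Fin 2 → (Fin 3 → ℕ)) i) 1
    have hnot : v ∉ (GModel.initial (p := p) (g₀ := g₀) hq h₀).V.basicOpen (algebraMap Γ((GModel.initial (p := p) (g₀ := g₀) hq h₀).V, O.1) Γ((GModel.initial (p := p) (g₀ := g₀) hq h₀).V, (GModel.initial (p := p) (g₀ := g₀) hq h₀).V.basicOpen ((eI i).symm (hh i))) ((eI i).symm (X 1))) := ReesFiltration.not_mem_basicOpen_of_mem_support (𝒦 i) hD (hw i 1) ⟨(basicOpenStable (GModel.initial (p := p) (g₀ := g₀) hq h₀).act O hO (actO_symm_eq_of_fixed hG (GModel.initial (p := p) (g₀ := g₀) hq h₀) O (eI i) (σI i) (hactI i) (hh i) (hσh i))).1, hWaff i⟩ _ hs1 hv hvW; rw [RingHom.algebraMap_toAlgebra, Scheme.basicOpen_res] at hnot; exact hnot ⟨(hW1 i).le hvW, hvB⟩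
  have hWle : ∀ i j, i ≠ j → (basicOpenStable (GModel.initial (p := p) (g₀ := g₀) hq h₀).act O hO (actO_symm_eq_of_fixed hG (GModel.initial (p := p) (g₀ := g₀) hq h₀) O (eI j) (σI j) (hactI j) (hh j) (hσh j))).1 ≤ (GModel.initial (p := p) (g₀ := g₀) hq h₀).V.basicOpen ((eI i).symm (X 1)) := by
    intro i j hij; have hdvd : (X 1 - C ((![(0 : k), a] : Fin 2 → k) i) : (MvPolynomial (Fin 4) k)) ∣ (γ j).symm (hh j) := by
      rw [hhh j, map_prod]; refine dvd_trans ?_ (Finset.dvd_prod_of_mem _ (Finset.mem_erase.mpr ⟨hij, Finset.mem_univ i⟩)); rw [map_prod]; refine dvd_trans ?_ (Finset.dvd_prod_of_mem _ (Finset.mem_univ (0 : ZMod p))); rw [ZMod.val_zero, Nat.cast_zero, zero_mul, add_zero, map_add, hγs1 j, show (γ j).symm (C ((![(0 : k), a] : Fin 2 → k) j - (![(0 : k), a] : Fin 2 → k) i)) = C ((![(0 : k), a] : Fin 2 → k) j - (![(0 : k), a] : Fin 2 → k) i) from (γ j).symm.commutes _, map_sub]; exact ⟨1, by ring⟩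
    obtain ⟨cc, hcc⟩ := hdvd; rw [hW1 j, heIs j, hcc, map_mul, Scheme.basicOpen_mul, heIs i, hγs1]; exact inf_le_left
  have hdisj : Pairwise fun i j => Disjoint ((((𝒦 i).ideal D).support : Set (GModel.initial (p := p) (g₀ := g₀) hq h₀).V)) ((((𝒦 j).ideal D).support : Set (GModel.initial (p := p) (g₀ := g₀) hq h₀).V)) := fun i j hij => Set.disjoint_left.mpr fun v hvi hvj => hBsub i v hvi (hWle i j hij (hsuppD j hvj)); have hWoff : ∀ i j, j ≠ i → Disjoint (((basicOpenStable (GModel.initial (p := p) (g₀ := g₀) hq h₀).act O hO (actO_symm_eq_of_fixed hG (GModel.initial (p := p) (g₀ := g₀) hq h₀) O (eI i) (σI i) (hactI i) (hh i) (hσh i))).1 : Set (GModel.initial (p := p) (g₀ := g₀) hq h₀).V)) ((((𝒦 j).ideal D).support : Set (GModel.initial (p := p) (g₀ := g₀) hq h₀).V)) := fun i j hji => Set.disjoint_left.mpr fun v hvW hvj => hBsub j v hvj (hWle j i hji hvW); have hadmg := MultiRoot.isAdmissibleCentre_infRees_of_disjoint (GModel.initial (p := p) (g₀ := g₀) hq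 h₀) 𝒦 hD hadmD hdisj; have h𝒦G : ∀ (g' : G) (n : ℕ), ((infRees 𝒦).ideal n).comap ((GModel.initial (p := p) (g₀ := g₀) hq h₀).act.aut g').hom = (infRees 𝒦).ideal n := hadmg.2.1; have h𝒦O : ∀ i n, ((infRees 𝒦).filtration ⟨(basicOpenStable (GModel.initial (p := p) (g₀ := g₀) hq h₀).act O hO (actO_symm_eq_of_fixed hG (GModel.initial (p := p) (g₀ := g₀) hq h₀) O (eI i) (σI i) (hactI i) (hh i) (hσh i))).1, hWaff i⟩).ideal n = ((traceFiltration (𝒜u i) (fun l => algebraMap (MvPolynomial (Fin 4) k) (Localization.Away (hh i)) (X ((![0, 1, 2] : Fin 3 → Fin 4) l))) ((![(![9, 2, 3] : Fin 3 → ℕ), (![3, 1, 2] : Fin 3 → ℕ)] : Fin 2 → (Fin 3 → ℕ)) i)).ideal n).comap (eW i : Γ((GModel.initial (p := p) (g₀ := g₀) hq h₀).V, (basicOpenStable (GModel.initial (p := p) (g₀ := g₀) hq h₀).act O hO (actO_symm_eq_of_fixed hG (GModel.initial (p := p) (g₀ := g₀) hq h₀) O (eI i) (σI i) (hactI i) (hh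 i) (hσh i))).1) →+* ↥(𝒜u i 0)) := fun i n => (MultiRoot.filtration_infRees_eq_of_disjoint 𝒦 hD ⟨(basicOpenStable (GModel.initial (p := p) (g₀ := g₀) hq h₀).act O hO (actO_symm_eq_of_fixed hG (GModel.initial (p := p) (g₀ := g₀) hq h₀) O (eI i) (σI i) (hactI i) (hh i) (hσh i))).1, hWaff i⟩ i (hWoff i) n).trans (hfil i n); have hsuppW : (((((infRees 𝒦).ideal D).support : Set (GModel.initial (p := p) (g₀ := g₀) hq h₀).V))) ⊆ ⋃ i, ((basicOpenStable (GModel.initial (p := p) (g₀ := g₀) hq h₀).act O hO (actO_symm_eq_of_fixed hG (GModel.initial (p := p) (g₀ := g₀) hq h₀) O (eI i) (σI i) (hactI i) (hh i) (hσh i))).1 : Set (GModel.initial (p := p) (g₀ := g₀) hq h₀).V) := (MultiRoot.support_infRees_subset 𝒦 D).trans (Set.iUnion_mono fun i => hsuppD i); have hb : ∀ i, e₀ ((eI i).symm (hh i)) = ∏ j ∈ Finset.univ.erase i, ∏ l : ZMod p, (X 1 - C ((![(0 : k), a] : Fin 2 → k) i) + C ((![(0 : k), a] : Fin 2 → k)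 i - (![(0 : k), a] : Fin 2 → k) j) + (l.val : (MvPolynomial (Fin 4) k)) * X 0) := by
    intro i; rw [heIs, e₀.apply_symm_apply, hhh i, map_prod]; refine Finset.prod_congr rfl fun j _ => ?_; rw [map_prod]; refine Finset.prod_congr rfl fun l _ => ?_; rw [map_add, map_add, map_mul, map_natCast, hγs1, hγs0, show (γ i).symm (C ((![(0 : k), a] : Fin 2 → k) i - (![(0 : k), a] : Fin 2 → k) j)) = C ((![(0 : k), a] : Fin 2 → k) i - (![(0 : k), a] : Fin 2 → k) j) from (γ i).symm.commutes _]
  have hF₀ : (NodeAtlasData.ofNodeAtlas (p := p) (ρ := (⟨ρ, hq⟩ : ActionOver q G)) (g₀ := g₀) h₀).fLocus ⊆ ⋃ i, ((basicOpenStable (GModel.initial (p := p) (g₀ := g₀) hq h₀).act O hO (actO_symm_eq_of_fixed hG (GModel.initial (p := p) (g₀ := g₀) hq h₀) O (eI i) (σI i) (hactI i) (hh i) (hσh i))).1 : Set (GModel.initial (p := p) (g₀ := g₀) hq h₀).V) := fLocus_subset_iUnion_basicOpen_locPoly hG (GModel.initial (p := p) (g₀ := g₀) hq h₀) O hOuniv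 e₀ σ hC h0 h1 hact (by decide : 0 < 2) (![(0 : k), a] : Fin 2 → k) hα (fun i => (eI i).symm (hh i)) hb _
  have hcovX : ∀ u : (GModel.initial (p := p) (g₀ := g₀) hq h₀).V, u ∈ (GModel.initial (p := p) (g₀ := g₀) hq h₀).V.basicOpen (e₀.symm (X 0)) ∨ ∃ i, u ∈ (basicOpenStable (GModel.initial (p := p) (g₀ := g₀) hq h₀).act O hO (actO_symm_eq_of_fixed hG (GModel.initial (p := p) (g₀ := g₀) hq h₀) O (eI i) (σI i) (hactI i) (hh i) (hσh i))).1 := fun u => mem_basicOpen_X_zero_or_locPoly (GModel.initial (p := p) (g₀ := g₀) hq h₀) O e₀ (by decide : 0 < 2) (![(0 : k), a] : Fin 2 → k) hα (fun i => (eI i).symm (hh i)) hb (hOuniv u)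
  refine ⟨infRees 𝒦, D, hadmg, fun M₁ hm₁ => ⟨⟨NodeAtlasData.ofNodeAtlas (p := p) (ρ := M₁.act) (g₀ := g₀) M₁.atlas⟩, ?_⟩⟩; obtain ⟨π₁, hbl, hπM, hrM, hcomm⟩ := hm₁; haveI : M₁.V.IsSeparated := isSeparated_of_datum φ M₁; haveI : IsIntegral M₁.V := M₁.isIntegral; have hkk : 0 < (p * 18) := Nat.mul_pos hp.pos (by decide)
  have hn₀ : ∀ i, 0 < ((![2 * D * p, 6 * D * p] : Fin 2 → ℕ) i) := fun i => by fin_cases i <;> simp [hD, hp.pos]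
  have hn₁ : ∀ i, 0 < ((![9 * D, 18 * D] : Fin 2 → ℕ) i) := fun i => by fin_cases i <;> simp [hD]
  have hn₂ : ∀ i, 0 < ((![6 * D, 9 * D] : Fin 2 → ℕ) i) := fun i => by fin_cases i <;> simp [hD]
  have hd₀ : ∀ i, (D * (p * 18)) = ((![(![9, 2, 3] : Fin 3 → ℕ), (![3, 1, 2] : Fin 3 → ℕ)] : Fin 2 → (Fin 3 → ℕ)) i) 0 * ((![2 * D * p, 6 * D * p] : Fin 2 → ℕ) i) := fun i => by fin_cases i <;> simp <;> ring
  have hd₁ : ∀ i, (D * (p * 18)) = p * ((![(![9, 2, 3] : Fin 3 → ℕ), (![3, 1, 2] : Fin 3 → ℕ)] : Fin 2 → (Fin 3 → ℕ)) i) 1 * ((![9 * D, 18 * D] : Fin 2 → ℕ) i) := fun i => by fin_cases i <;> simp <;> ring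
  have hd₂ : ∀ i, (D * (p * 18)) = p * ((![(![9, 2, 3] : Fin 3 → ℕ), (![3, 1, 2] : Fin 3 → ℕ)] : Fin 2 → (Fin 3 → ℕ)) i) 2 * ((![6 * D, 9 * D] : Fin 2 → ℕ) i) := fun i => by fin_cases i <;> simp <;> ring
  have hrd := fun i => Cusp.cusp_ringData hp.pos a c (σI i) (hCI i) (h0I i) (h1I i) i (h2I i) (h3I i) (hh i) (hσh i) (hh0 i) (hσpI i) (hσpL i) (hσJ i) ![] (𝒜u i) (hfull0 i) (D * (p * 18)) ((![2 * D * p, 6 * D * p] : Fin 2 → ℕ) i) ((![9 * D, 18 * D] : Fin 2 → ℕ) i) ((![6 * D, 9 * D] : Fin 2 → ℕ) i) (hn₀ i) (hn₁ i) (hn₂ i) (hd₀ i) (hd₁ i) (hd₂ i); choose y hy hσy hy0 hy1 hy2 hcov0 hcov1 hcov2 hrad hres using hrd; have hnT : ∀ i, 0 < ((![3 * D * p, 9 * D * p] : Fin 2 → ℕ) i) := fun i => by fin_cases i <;> simp [hD, hp.pos]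
  have hdT : ∀ i, (D * (p * 18)) = ((![6, 2] : Fin 2 → ℕ) i) * ((![3 * D * p, 9 * D * p] : Fin 2 → ℕ) i) := fun i => by fin_cases i <;> simp <;> ring
  have hresT := fun i j => QhAbs.qha_residualSection_tail (fun l => algebraMap (MvPolynomial (Fin 4) k) (Localization.Away (hh i)) (X ((![0, 1, 2] : Fin 3 → Fin 4) l))) (algebraMap (MvPolynomial (Fin 4) k) (Localization.Away (hh i)) ((![(X 2 ^ 2 - X 1 ^ 3 : MvPolynomial (Fin 4) k), (X 2 ^ 2 + 2 * X 1 * X 2 + C (2 * c) * X 2 + C (1 - 3 * a) * X 1 ^ 2 - X 1 ^ 3 : MvPolynomial (Fin 4) k)] : Fin 2 → (MvPolynomial (Fin 4) k)) i)) ((![(![9, 2, 3] : Fin 3 → ℕ), (![3, 1, 2] : Fin 3 → ℕ)] : Fin 2 → (Fin 3 → ℕ)) i) ((![6, 2] : Fin 2 → ℕ) i) (ht i) ![] (𝒜u i) (hfA i) (hfull0 i _) (y i j) (hy i j) ((![3 * D * p, 9 * D * p] : Fin 2 → ℕ) i) (hdT i) _ (hrest1 i) (hnT i); obtain ⟨OW,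 hOWaff, hOWeq, E, htame', hE', hpin, 𝔄₁, hF₁⟩ := exists_moveAtlas_of_nodes hp.pos hG (GModel.initial (p := p) (g₀ := g₀) hq h₀) M₁ (NodeAtlasData.ofNodeAtlas (p := p) (ρ := (⟨ρ, hq⟩ : ActionOver q G)) (g₀ := g₀) h₀) (fun i => (basicOpenStable (GModel.initial (p := p) (g₀ := g₀) hq h₀).act O hO (actO_symm_eq_of_fixed hG (GModel.initial (p := p) (g₀ := g₀) hq h₀) O (eI i) (σI i) (hactI i) (hh i) (hσh i)))) hWaff ![] 𝒜u (fun i => (fun l => algebraMap (MvPolynomial (Fin 4) k) (Localization.Away (hh i)) (X ((![0, 1, 2] : Fin 3 → Fin 4) l)))) (δ := fun _ _ => (0 : (Π j : Fin 0, ZMod ((![] : Fin 0 → ℕ) j)))) (fun i => ((![(![9, 2, 3] : Fin 3 → ℕ), (![3, 1, 2] : Fin 3 → ℕ)] : Fin 2 → (Fin 3 → ℕ)) i)) hfA (fun i => (sigmaAway (σI i) (hσh i))) eW htame hσpL hσW hw hK1 hK1' hσJ (infRees 𝒦) D h𝒦G h𝒦O hverD hsuppW π₁ hbl hrM hcomm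 hkk y hy hσy hrad (fun i => cobordantAlgebra.s (fun l => algebraMap (MvPolynomial (Fin 4) k) (Localization.Away (hh i)) (X ((![0, 1, 2] : Fin 3 → Fin 4) l))) ((![(![9, 2, 3] : Fin 3 → ℕ), (![3, 1, 2] : Fin 3 → ℕ)] : Fin 2 → (Fin 3 → ℕ)) i) ^ ((![6, 2] : Fin 2 → ℕ) i)) H1 (fun _ _ => 2) (fun i j => ![algebraMap _ (ChartRing (𝒜u i) (fun l => algebraMap (MvPolynomial (Fin 4) k) (Localization.Away (hh i)) (X ((![0, 1, 2] : Fin 3 → Fin 4) l))) ((![(![9, 2, 3] : Fin 3 → ℕ), (![3, 1, 2] : Fin 3 → ℕ)] : Fin 2 → (Fin 3 → ℕ)) i) (D * (p * 18)) (y i j) (hy i j)) (cobordantAlgebra.u' (fun l => algebraMap (MvPolynomial (Fin 4) k) (Localization.Away (hh i)) (X ((![0, 1, 2] : Fin 3 → Fin 4) l))) ((![(![9, 2, 3] : Fin 3 → ℕ), (![3, 1, 2] : Fin 3 → ℕ)] : Fin 2 → (Fin 3 → ℕ)) i) 0 ^ ((![2 * D * p, 6 * D * p] : Fin 2 → ℕ)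 i)) * IsLocalization.Away.invSelf ((coverElement (𝒜u i) (fun l => algebraMap (MvPolynomial (Fin 4) k) (Localization.Away (hh i)) (X ((![0, 1, 2] : Fin 3 → Fin 4) l))) ((![(![9, 2, 3] : Fin 3 → ℕ), (![3, 1, 2] : Fin 3 → ℕ)] : Fin 2 → (Fin 3 → ℕ)) i) (D * (p * 18))) (y i j) (hy i j)), algebraMap _ (ChartRing (𝒜u i) (fun l => algebraMap (MvPolynomial (Fin 4) k) (Localization.Away (hh i)) (X ((![0, 1, 2] : Fin 3 → Fin 4) l))) ((![(![9, 2, 3] : Fin 3 → ℕ), (![3, 1, 2] : Fin 3 → ℕ)] : Fin 2 → (Fin 3 → ℕ)) i) (D * (p * 18)) (y i j) (hy i j)) ((⟨_, C_mul_T_mem_cobordantAlgebra _ _ (ht i)⟩ : ↥(cobordantAlgebra (fun l => algebraMap (MvPolynomial (Fin 4) k) (Localization.Away (hh i)) (X ((![0, 1, 2] : Fin 3 → Fin 4) l))) ((![(![9, 2, 3] : Fin 3 → ℕ), (![3, 1, 2] : Fin 3 → ℕ)] : Fin 2 → (Fin 3 → ℕ)) i))) ^ ((![3 * D * p, 9 *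 D * p] : Fin 2 → ℕ) i)) * IsLocalization.Away.invSelf ((coverElement (𝒜u i) (fun l => algebraMap (MvPolynomial (Fin 4) k) (Localization.Away (hh i)) (X ((![0, 1, 2] : Fin 3 → Fin 4) l))) ((![(![9, 2, 3] : Fin 3 → ℕ), (![3, 1, 2] : Fin 3 → ℕ)] : Fin 2 → (Fin 3 → ℕ)) i) (D * (p * 18))) (y i j) (hy i j))]) (fun i j l => Fin.cases (hres i j).1 (Fin.cases (hresT i j).1 (fun l' => l'.elim0)) l) (fun i j l => Fin.cases (hres i j).2 (Fin.cases (hresT i j).2 (fun l' => l'.elim0)) l); have hWle₁ : ∀ i j, (OW i j).1 ≤ π₁ ⁻¹ᵁ (basicOpenStable (GModel.initial (p := p) (g₀ := g₀) hq h₀).act O hO (actO_symm_eq_of_fixed hG (GModel.initial (p := p) (g₀ := g₀) hq h₀) O (eI i) (σI i) (hactI i) (hh i) (hσh i))).1 := fun i j => by rw [hOWeq i j]; exact blowupChart_le_preimage π₁ _ ⟨(basicOpenStable (GModel.initial (p := p) (g₀ := g₀) hq h₀).act O hO (actO_symm_eq_of_fixed hG (GModel.initial (p := p) (g₀ := g₀)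 hq h₀) O (eI i) (σI i) (hactI i) (hh i) (hσh i))).1, hWaff i⟩ _
  have hunit0 : ∀ i, algebraMap _ (ChartRing (𝒜u i) (fun l => algebraMap (MvPolynomial (Fin 4) k) (Localization.Away (hh i)) (X ((![0, 1, 2] : Fin 3 → Fin 4) l))) ((![(![9, 2, 3] : Fin 3 → ℕ), (![3, 1, 2] : Fin 3 → ℕ)] : Fin 2 → (Fin 3 → ℕ)) i) (D * (p * 18)) (y i 0) (hy i 0)) (cobordantAlgebra.u' (fun l => algebraMap (MvPolynomial (Fin 4) k) (Localization.Away (hh i)) (X ((![0, 1, 2] : Fin 3 → Fin 4) l))) ((![(![9, 2, 3] : Fin 3 → ℕ), (![3, 1, 2] : Fin 3 → ℕ)] : Fin 2 → (Fin 3 → ℕ)) i) 0 ^ ((![2 * D * p, 6 * D * p] : Fin 2 → ℕ) i)) * IsLocalization.Away.invSelf ((coverElement (𝒜u i) (fun l => algebraMap (MvPolynomial (Fin 4) k) (Localization.Away (hh i)) (X ((![0, 1, 2] : Fin 3 → Fin 4) l))) ((![(![9, 2, 3] : Fin 3 → ℕ), (![3, 1, 2] : Fin 3 → ℕ)] : Fin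 2 → (Fin 3 → ℕ)) i) (D * (p * 18))) (y i 0) (hy i 0)) = 1 := fun i => by rw [← hcov0 i]; exact IsLocalization.Away.mul_invSelf _
  have hz0W : ∀ i, ∀ v ∈ (OW i 0).1, v ∈ M₁.V.basicOpen (letI := chartNodeGradedRing ![] (𝒜u i) (fun l => algebraMap (MvPolynomial (Fin 4) k) (Localization.Away (hh i)) (X ((![0, 1, 2] : Fin 3 → Fin 4) l))) ((![(![9, 2, 3] : Fin 3 → ℕ), (![3, 1, 2] : Fin 3 → ℕ)] : Fin 2 → (Fin 3 → ℕ)) i) (hfA i) (D * (p * 18)) (y i 0) (hy i 0); (E i 0).symm ⟨_, (hres i 0).1⟩) := fun i v hv => by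
    letI := chartNodeGradedRing ![] (𝒜u i) (fun l => algebraMap (MvPolynomial (Fin 4) k) (Localization.Away (hh i)) (X ((![0, 1, 2] : Fin 3 → Fin 4) l))) ((![(![9, 2, 3] : Fin 3 → ℕ), (![3, 1, 2] : Fin 3 → ℕ)] : Fin 2 → (Fin 3 → ℕ)) i) (hfA i) (D * (p * 18)) (y i 0) (hy i 0); rw [show (⟨_, (hres i 0).1⟩ : ↥((chartNodeGrading ![] (𝒜u i) (fun l => algebraMap (MvPolynomial (Fin 4) k) (Localization.Away (hh i)) (X ((![0, 1, 2] : Fin 3 → Fin 4) l))) ((![(![9, 2, 3] : Fin 3 → ℕ), (![3, 1, 2] : Fin 3 → ℕ)] : Fin 2 → (Fin 3 → ℕ)) i) (hfA i) (D * (p * 18)) (y i 0) (hy i 0)) 0)) = 1 from Subtype.ext (hunit0 i), map_one, Scheme.basicOpen_of_isUnit _ isUnit_one]; exact hv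
  have hπ' : IsBlowup π₁ ((infRees 𝒦).ideal D ^ (p * 18)) := isBlowup_pow hbl hkk.ne'; have hverbar : ∀ i, VeroneseNormalised (𝒜u i) (fun l => algebraMap (MvPolynomial (Fin 4) k) (Localization.Away (hh i)) (X ((![0, 1, 2] : Fin 3 → Fin 4) l))) ((![(![9, 2, 3] : Fin 3 → ℕ), (![3, 1, 2] : Fin 3 → ℕ)] : Fin 2 → (Fin 3 → ℕ)) i) (D * (p * 18)) := fun i => CoarseChart.veroneseNormalised_mul _ _ _ (hverD i) hkk; have hJ' : ∀ i, ((infRees 𝒦).ideal D ^ (p * 18)).ideal ⟨(basicOpenStable (GModel.initial (p := p) (g₀ := g₀) hq h₀).act O hO (actO_symm_eq_of_fixed hG (GModel.initial (p := p) (g₀ := g₀) hq h₀) O (eI i) (σI i) (hactI i) (hh i) (hσh i))).1, hWaff i⟩ = ((traceFiltration (𝒜u i) (fun l => algebraMap (MvPolynomial (Fin 4) k) (Localization.Away (hh i)) (X ((![0, 1, 2] : Fin 3 → Fin 4) l))) ((![(![9, 2, 3] : Fin 3 → ℕ), (![3, 1, 2] : Fin 3 → ℕ)] : Fin 2 → (Fin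 3 → ℕ)) i)).ideal (D * (p * 18))).comap (eW i : Γ((GModel.initial (p := p) (g₀ := g₀) hq h₀).V, (basicOpenStable (GModel.initial (p := p) (g₀ := g₀) hq h₀).act O hO (actO_symm_eq_of_fixed hG (GModel.initial (p := p) (g₀ := g₀) hq h₀) O (eI i) (σI i) (hactI i) (hh i) (hσh i))).1) →+* ↥(𝒜u i 0)) := fun i => by
    rw [Scheme.IdealSheafData.ideal_pow, Pi.pow_apply, ← ReesFiltration.filtration_ideal, h𝒦O i D, (hverD i).2 (p * 18), comap_equiv_pow]
  have hxJ : ∀ i j, (eW i).symm (y i j) ∈ ((infRees 𝒦).ideal D ^ (p * 18)).ideal ⟨(basicOpenStable (GModel.initial (p := p) (g₀ := g₀) hq h₀).act O hO (actO_symm_eq_of_fixed hG (GModel.initial (p := p) (g₀ := g₀) hq h₀) O (eI i) (σI i) (hactI i) (hh i) (hσh i))).1, hWaff i⟩ := fun i j => by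
    rw [hJ' i, Ideal.mem_comap, RingHom.coe_coe, (eW i).apply_symm_apply]; exact hy i j
  have hcovM : ∀ (x : M₁.V) i, π₁.base x ∈ (basicOpenStable (GModel.initial (p := p) (g₀ := g₀) hq h₀).act O hO (actO_symm_eq_of_fixed hG (GModel.initial (p := p) (g₀ := g₀) hq h₀) O (eI i) (σI i) (hactI i) (hh i) (hσh i))).1 → ∃ j, x ∈ (OW i j).1 := fun x i hxi => by
    have hcovW := iSup_blowupChart_eq_preimage (I := (infRees 𝒦).ideal D) (GModel.initial (p := p) (g₀ := g₀) hq h₀).act ![] (𝒜u i) (fun l => algebraMap (MvPolynomial (Fin 4) k) (Localization.Away (hh i)) (X ((![0, 1, 2] : Fin 3 → Fin 4) l))) ((![(![9, 2, 3] : Fin 3 → ℕ), (![3, 1, 2] : Fin 3 → ℕ)] : Fin 2 → (Fin 3 → ℕ)) i) (hfA i) (basicOpenStable (GModel.initial (p := p) (g₀ := g₀) hq h₀).act O hO (actO_symm_eq_of_fixed hG (GModel.initial (p := p) (g₀ := g₀) hq h₀) O (eI i) (σI i) (hactI i) (hh i) (hσh i))) (hWaff i) (eW i) hπ' (hverbar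 i) (hJ' i) (y i) (hy i) (hrad i); obtain ⟨j, hj⟩ := Opens.mem_iSup.mp (show x ∈ ⨆ j, blowupChart π₁ ((infRees 𝒦).ideal D ^ (p * 18)) ⟨(basicOpenStable (GModel.initial (p := p) (g₀ := g₀) hq h₀).act O hO (actO_symm_eq_of_fixed hG (GModel.initial (p := p) (g₀ := g₀) hq h₀) O (eI i) (σI i) (hactI i) (hh i) (hσh i))).1, hWaff i⟩ ((eW i).symm (y i j)) by rw [hcovW]; exact hxi)
    exact ⟨j, (congrArg (fun U : M₁.V.Opens => x ∈ U) (hOWeq i j)).mpr hj⟩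
  have htrans : ∀ i (j j' : Fin 3), letI := chartNodeGradedRing ![] (𝒜u i) (fun l => algebraMap (MvPolynomial (Fin 4) k) (Localization.Away (hh i)) (X ((![0, 1, 2] : Fin 3 → Fin 4) l))) ((![(![9, 2, 3] : Fin 3 → ℕ), (![3, 1, 2] : Fin 3 → ℕ)] : Fin 2 → (Fin 3 → ℕ)) i) (hfA i) (D * (p * 18)) (y i j) (hy i j); ∃ t : Γ(M₁.V, (OW i j).1), ((E i j t : ↥((chartNodeGrading ![] (𝒜u i) (fun l => algebraMap (MvPolynomial (Fin 4) k) (Localization.Away (hh i)) (X ((![0, 1, 2] : Fin 3 → Fin 4) l))) ((![(![9, 2, 3] : Fin 3 → ℕ), (![3, 1, 2] : Fin 3 → ℕ)] : Fin 2 → (Fin 3 → ℕ)) i) (hfA i) (D * (p * 18)) (y i j) (hy i j)) 0)) : (ChartRing (𝒜u i) (fun l => algebraMap (MvPolynomial (Fin 4) k) (Localization.Away (hh i)) (X ((![0, 1, 2] : Fin 3 → Fin 4) l))) ((![(![9, 2, 3] : Fin 3 → ℕ), (![3, 1, 2] : Fin 3 → ℕ)] : Fin 2 → (Fin 3 → ℕ))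 i) (D * (p * 18)) (y i j) (hy i j))) = algebraMap _ (ChartRing (𝒜u i) (fun l => algebraMap (MvPolynomial (Fin 4) k) (Localization.Away (hh i)) (X ((![0, 1, 2] : Fin 3 → Fin 4) l))) ((![(![9, 2, 3] : Fin 3 → ℕ), (![3, 1, 2] : Fin 3 → ℕ)] : Fin 2 → (Fin 3 → ℕ)) i) (D * (p * 18)) (y i j) (hy i j)) ((coverElement (𝒜u i) (fun l => algebraMap (MvPolynomial (Fin 4) k) (Localization.Away (hh i)) (X ((![0, 1, 2] : Fin 3 → Fin 4) l))) ((![(![9, 2, 3] : Fin 3 → ℕ), (![3, 1, 2] : Fin 3 → ℕ)] : Fin 2 → (Fin 3 → ℕ)) i) (D * (p * 18))) (y i j') (hy i j')) * IsLocalization.Away.invSelf ((coverElement (𝒜u i) (fun l => algebraMap (MvPolynomial (Fin 4) k) (Localization.Away (hh i)) (X ((![0, 1, 2] : Fin 3 → Fin 4) l))) ((![(![9, 2, 3] : Fin 3 → ℕ), (![3, 1, 2] : Fin 3 → ℕ)] : Fin 2 → (Fin 3 → ℕ)) i) (D * (p * 18))) (y i j) (hy i j)) ∧ ∀ v ∈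 (OW i j).1, v ∈ (OW i j').1 → v ∈ M₁.V.basicOpen t := by
    intro i j j'; letI := chartNodeGradedRing ![] (𝒜u i) (fun l => algebraMap (MvPolynomial (Fin 4) k) (Localization.Away (hh i)) (X ((![0, 1, 2] : Fin 3 → Fin 4) l))) ((![(![9, 2, 3] : Fin 3 → ℕ), (![3, 1, 2] : Fin 3 → ℕ)] : Fin 2 → (Fin 3 → ℕ)) i) (hfA i) (D * (p * 18)) (y i j) (hy i j); have hmem := transitionSection_mem_chartNodeGrading_zero ![] (𝒜u i) (fun l => algebraMap (MvPolynomial (Fin 4) k) (Localization.Away (hh i)) (X ((![0, 1, 2] : Fin 3 → Fin 4) l))) ((![(![9, 2, 3] : Fin 3 → ℕ), (![3, 1, 2] : Fin 3 → ℕ)] : Fin 2 → (Fin 3 → ℕ)) i) (hfA i) (y i j) (hy i j) (y i j') (hy i j'); have hpz : (E i j).symm ⟨_, hmem⟩ * π₁.appLE (basicOpenStable (GModel.initial (p := p) (g₀ := g₀) hq h₀).act O hO (actO_symm_eq_of_fixed hG (GModel.initial (p := p) (g₀ := g₀) hq h₀) O (eI i) (σI i) (hactI i) (hh i) (hσh i))).1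 (OW i j).1 (hWle₁ i j) ((eW i).symm (y i j)) = π₁.appLE (basicOpenStable (GModel.initial (p := p) (g₀ := g₀) hq h₀).act O hO (actO_symm_eq_of_fixed hG (GModel.initial (p := p) (g₀ := g₀) hq h₀) O (eI i) (σI i) (hactI i) (hh i) (hσh i))).1 (OW i j).1 (hWle₁ i j) ((eW i).symm (y i j')) := symm_mul_appLE_eq_of_pin π₁ (basicOpenStable (GModel.initial (p := p) (g₀ := g₀) hq h₀).act O hO (actO_symm_eq_of_fixed hG (GModel.initial (p := p) (g₀ := g₀) hq h₀) O (eI i) (σI i) (hactI i) (hh i) (hσh i))).1 (OW i j).1 (hWle₁ i j) (chartNodeGrading ![] (𝒜u i) (fun l => algebraMap (MvPolynomial (Fin 4) k) (Localization.Away (hh i)) (X ((![0, 1, 2] : Fin 3 → Fin 4) l))) ((![(![9, 2, 3] : Fin 3 → ℕ), (![3, 1, 2] : Fin 3 → ℕ)] : Fin 2 → (Fin 3 → ℕ)) i) (hfA i) (D * (p * 18)) (y i j) (hy i j)) (E i j) (eW i) (toChartRing (𝒜u i) (fun l => algebraMap (MvPolynomial (Fin 4) k) (Localization.Away (hh i))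 (X ((![0, 1, 2] : Fin 3 → Fin 4) l))) ((![(![9, 2, 3] : Fin 3 → ℕ), (![3, 1, 2] : Fin 3 → ℕ)] : Fin 2 → (Fin 3 → ℕ)) i) (D * (p * 18)) (y i j) (hy i j)) (hpin i j (hWle₁ i j)) ⟨_, hmem⟩ ((eW i).symm (y i j')) ((eW i).symm (y i j)) (y i j') (y i j) ((eW i).apply_symm_apply _) ((eW i).apply_symm_apply _) (coverElement_section_pin ![] (𝒜u i) (fun l => algebraMap (MvPolynomial (Fin 4) k) (Localization.Away (hh i)) (X ((![0, 1, 2] : Fin 3 → Fin 4) l))) ((![(![9, 2, 3] : Fin 3 → ℕ), (![3, 1, 2] : Fin 3 → ℕ)] : Fin 2 → (Fin 3 → ℕ)) i) (y i j) (hy i j) (y i j') (hy i j')); refine ⟨(E i j).symm ⟨_, hmem⟩, by rw [(E i j).apply_symm_apply], fun v hvW hv' => ?_⟩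
    exact mem_basicOpen_of_mem_blowupChart_of_mul_appLE_eq hπ' ⟨(basicOpenStable (GModel.initial (p := p) (g₀ := g₀) hq h₀).act O hO (actO_symm_eq_of_fixed hG (GModel.initial (p := p) (g₀ := g₀) hq h₀) O (eI i) (σI i) (hactI i) (hh i) (hσh i))).1, hWaff i⟩ (hxJ i j) (le_of_eq (hOWeq i j)) _ hpz hvW ((congrArg (fun U : M₁.V.Opens => v ∈ U) (hOWeq i j')).mp hv')
  choose tr htrE htrU using htrans; have hγ0 : ∀ i, γ i (X 0) = X 0 := fun i => (hrest i).2.1.1; have hγ1 : ∀ i, γ i (X 1) = X 1 + C ((![(0 : k), a] : Fin 2 → k) i) := fun i => (hrest i).2.1.2.1; have hγ2 : ∀ i, γ i (X 2) = (![(X 2 : MvPolynomial (Fin 4) k), (X 2 + X 1 + C c : MvPolynomial (Fin 4) k)] : Fin 2 → (MvPolynomial (Fin 4) k)) i := fun i => (hrest i).2.1.2.2.1; have hO1 : ∀ i j, (OW i j).1 ≤ π₁ ⁻¹ᵁ O.1 := fun i j x _ => Set.mem_univ _; obtain ⟨ξO, hξO⟩ : ∃ ξO : (MvPolynomial (Fin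 4) k), ξO = 2 * X 2 - 3 * X 1 ^ 2 := ⟨_, rfl⟩; obtain ⟨fO, hfO⟩ : ∃ fO : (MvPolynomial (Fin 4) k), fO = X 2 ^ 2 - X 1 ^ 3 := ⟨_, rfl⟩; have hQ1' : (2 : MvPolynomial (Fin 4) k) * C c = 3 * C a ^ 2 := by
    rw [← map_ofNat (C : k →+* MvPolynomial (Fin 4) k) 2, ← map_ofNat (C : k →+* MvPolynomial (Fin 4) k) 3, ← map_pow, ← map_mul, ← map_mul, hQ1]
  have hQ2' : (C c : MvPolynomial (Fin 4) k) ^ 2 = C a ^ 3 := by rw [← map_pow, ← map_pow, hQ2]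
  have hγξ : ∀ i, γ i ξO = ((![(2 * X 2 - 3 * X 1 ^ 2 : MvPolynomial (Fin 4) k), (2 * X 2 + C (2 * (1 - 3 * a)) * X 1 - 3 * X 1 ^ 2 : MvPolynomial (Fin 4) k)] : Fin 2 → (MvPolynomial (Fin 4) k)) i) := by
    intro i; rw [hξO, map_sub, map_mul, map_mul, map_pow, hγ1, hγ2, map_ofNat, map_ofNat]; fin_cases i
    · simp only [Fin.zero_eta, Fin.isValue, Matrix.cons_val_zero, map_zero, add_zero]
    · simp only [Fin.mk_one, Fin.isValue, Matrix.cons_val_one, Matrix.cons_val_zero, map_mul, map_sub, map_one, map_ofNat]; linear_combination hQ1'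
  have hγf : ∀ i, γ i fO = ((![(X 2 ^ 2 - X 1 ^ 3 : MvPolynomial (Fin 4) k), (X 2 ^ 2 + 2 * X 1 * X 2 + C (2 * c) * X 2 + C (1 - 3 * a) * X 1 ^ 2 - X 1 ^ 3 : MvPolynomial (Fin 4) k)] : Fin 2 → (MvPolynomial (Fin 4) k)) i) := by
    intro i; rw [hfO, map_sub, map_pow, map_pow, hγ1, hγ2]; fin_cases i
    · simp only [Fin.zero_eta, Fin.isValue, Matrix.cons_val_zero, map_zero, add_zero]
    · simp only [Fin.mk_one, Fin.isValue, Matrix.cons_val_one, Matrix.cons_val_zero, map_mul, map_sub, map_one, map_ofNat]; linear_combination hQ2' + X 1 * hQ1'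
  have hWO : ∀ i, (basicOpenStable (GModel.initial (p := p) (g₀ := g₀) hq h₀).act O hO (actO_symm_eq_of_fixed hG (GModel.initial (p := p) (g₀ := g₀) hq h₀) O (eI i) (σI i) (hactI i) (hh i) (hσh i))).1 ≤ O.1 := fun i => (GModel.initial (p := p) (g₀ := g₀) hq h₀).V.basicOpen_le _; obtain ⟨sW, hsW⟩ : ∃ sW : ∀ i, Γ((GModel.initial (p := p) (g₀ := g₀) hq h₀).V, O.1) →+* Γ((GModel.initial (p := p) (g₀ := g₀) hq h₀).V, (basicOpenStable (GModel.initial (p := p) (g₀ := g₀) hq h₀).act O hO (actO_symm_eq_of_fixed hG (GModel.initial (p := p) (g₀ := g₀) hq h₀) O (eI i) (σI i) (hactI i) (hh i) (hσh i))).1), sW = fun i => ((GModel.initial (p := p) (g₀ := g₀) hq h₀).V.presheaf.map (homOfLE (hWO i)).op).hom := ⟨_, rfl⟩; have hpinW' : ∀ i (t : Γ((GModel.initial (p := p) (g₀ := g₀) hq h₀).V, O.1)), ((eW i (sW i t) : ↥(𝒜u i 0)) : (Localization.Away (hh i))) = algebraMap (MvPolynomial (Fin 4) k) (Localization.Away (hh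 i)) (eI i t) := fun i t => by rw [hsW]; exact hpinW i t
  have hresW : ∀ i j (t : Γ((GModel.initial (p := p) (g₀ := g₀) hq h₀).V, O.1)), π₁.appLE (basicOpenStable (GModel.initial (p := p) (g₀ := g₀) hq h₀).act O hO (actO_symm_eq_of_fixed hG (GModel.initial (p := p) (g₀ := g₀) hq h₀) O (eI i) (σI i) (hactI i) (hh i) (hσh i))).1 (OW i j).1 (hWle₁ i j) (sW i t) = π₁.appLE O.1 (OW i j).1 (hO1 i j) t := fun i j t => by
    rw [hsW]; exact Scheme.Hom.map_appLE_apply π₁ (hWle₁ i j) (hWO i) (hO1 i j) t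
  have hEval : ∀ i j (t : Γ((GModel.initial (p := p) (g₀ := g₀) hq h₀).V, O.1)), letI := chartNodeGradedRing ![] (𝒜u i) (fun l => algebraMap (MvPolynomial (Fin 4) k) (Localization.Away (hh i)) (X ((![0, 1, 2] : Fin 3 → Fin 4) l))) ((![(![9, 2, 3] : Fin 3 → ℕ), (![3, 1, 2] : Fin 3 → ℕ)] : Fin 2 → (Fin 3 → ℕ)) i) (hfA i) (D * (p * 18)) (y i j) (hy i j); ((E i j (π₁.appLE O.1 (OW i j).1 (hO1 i j) t) : ↥((chartNodeGrading ![] (𝒜u i) (fun l => algebraMap (MvPolynomial (Fin 4) k) (Localization.Away (hh i)) (X ((![0, 1, 2] : Fin 3 → Fin 4) l))) ((![(![9, 2, 3] : Fin 3 → ℕ), (![3, 1, 2] : Fin 3 → ℕ)] : Fin 2 → (Fin 3 → ℕ)) i) (hfA i) (D * (p * 18)) (y i j) (hy i j)) 0)) : (ChartRing (𝒜u i) (fun l => algebraMap (MvPolynomial (Fin 4) k) (Localization.Away (hh i)) (X ((![0, 1, 2] : Fin 3 → Fin 4) l))) ((![(![9, 2, 3] : Fin 3 → ℕ), (![3, 1,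 2] : Fin 3 → ℕ)] : Fin 2 → (Fin 3 → ℕ)) i) (D * (p * 18)) (y i j) (hy i j))) = algebraMap ↥(cobordantAlgebra (fun l => algebraMap (MvPolynomial (Fin 4) k) (Localization.Away (hh i)) (X ((![0, 1, 2] : Fin 3 → Fin 4) l))) ((![(![9, 2, 3] : Fin 3 → ℕ), (![3, 1, 2] : Fin 3 → ℕ)] : Fin 2 → (Fin 3 → ℕ)) i)) (ChartRing (𝒜u i) (fun l => algebraMap (MvPolynomial (Fin 4) k) (Localization.Away (hh i)) (X ((![0, 1, 2] : Fin 3 → Fin 4) l))) ((![(![9, 2, 3] : Fin 3 → ℕ), (![3, 1, 2] : Fin 3 → ℕ)] : Fin 2 → (Fin 3 → ℕ)) i) (D * (p * 18)) (y i j) (hy i j)) (algebraMap (Localization.Away (hh i)) ↥(cobordantAlgebra (fun l => algebraMap (MvPolynomial (Fin 4) k) (Localization.Away (hh i)) (X ((![0, 1, 2] : Fin 3 → Fin 4) l))) ((![(![9, 2, 3] : Fin 3 → ℕ), (![3, 1, 2] : Fin 3 → ℕ)] : Fin 2 → (Fin 3 → ℕ)) i)) (algebraMap (MvPolynomial (Fin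 4) k) (Localization.Away (hh i)) (eI i t))) := by
    intro i j t; letI := chartNodeGradedRing ![] (𝒜u i) (fun l => algebraMap (MvPolynomial (Fin 4) k) (Localization.Away (hh i)) (X ((![0, 1, 2] : Fin 3 → Fin 4) l))) ((![(![9, 2, 3] : Fin 3 → ℕ), (![3, 1, 2] : Fin 3 → ℕ)] : Fin 2 → (Fin 3 → ℕ)) i) (hfA i) (D * (p * 18)) (y i j) (hy i j); rw [← hresW, hpin i j (hWle₁ i j), toChartRing_apply]; congr 2; exact hpinW' i t
  have htop : (⊤ : M₁.V.Opens) ≤ π₁ ⁻¹ᵁ O.1 := fun _ _ => Set.mem_univ _; have happ : ∀ i j (x : Γ((GModel.initial (p := p) (g₀ := g₀) hq h₀).V, O.1)), (M₁.V.presheaf.map (homOfLE (le_top : (OW i j).1 ≤ ⊤)).op).hom (π₁.appLE O.1 ⊤ htop x) = π₁.appLE O.1 (OW i j).1 (hO1 i j) x := fun i j x => Scheme.Hom.appLE_map_apply π₁ htop (le_top : (OW i j).1 ≤ ⊤) x; obtain ⟨r0, hr0d⟩ : ∃ r0 : ∀ i j, Γ(M₁.V, (OW i j).1), r0 = fun i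 j => π₁.appLE O.1 (OW i j).1 (hO1 i j) (e₀.symm (X 0)) := ⟨_, rfl⟩; obtain ⟨rxi, hrxid⟩ : ∃ rxi : ∀ i j, Γ(M₁.V, (OW i j).1), rxi = fun i j => π₁.appLE O.1 (OW i j).1 (hO1 i j) (e₀.symm ξO) := ⟨_, rfl⟩; obtain ⟨rt, hrtd⟩ : ∃ rt : ∀ i j, Γ(M₁.V, (OW i j).1), rt = fun i j => π₁.appLE O.1 (OW i j).1 (hO1 i j) (e₀.symm fO) := ⟨_, rfl⟩; have hr0 : ∀ i j, letI := chartNodeGradedRing ![] (𝒜u i) (fun l => algebraMap (MvPolynomial (Fin 4) k) (Localization.Away (hh i)) (X ((![0, 1, 2] : Fin 3 → Fin 4) l))) ((![(![9, 2, 3] : Fin 3 → ℕ), (![3, 1, 2] : Fin 3 → ℕ)] : Fin 2 → (Fin 3 → ℕ)) i) (hfA i) (D * (p * 18)) (y i j) (hy i j); ((E i j (r0 i j) : ↥((chartNodeGrading ![] (𝒜u i) (fun l => algebraMap (MvPolynomial (Fin 4) k) (Localization.Away (hh i)) (X ((![0, 1, 2] : Fin 3 → Fin 4) l))) ((![(![9,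 2, 3] : Fin 3 → ℕ), (![3, 1, 2] : Fin 3 → ℕ)] : Fin 2 → (Fin 3 → ℕ)) i) (hfA i) (D * (p * 18)) (y i j) (hy i j)) 0)) : (ChartRing (𝒜u i) (fun l => algebraMap (MvPolynomial (Fin 4) k) (Localization.Away (hh i)) (X ((![0, 1, 2] : Fin 3 → Fin 4) l))) ((![(![9, 2, 3] : Fin 3 → ℕ), (![3, 1, 2] : Fin 3 → ℕ)] : Fin 2 → (Fin 3 → ℕ)) i) (D * (p * 18)) (y i j) (hy i j))) = algebraMap ↥(cobordantAlgebra (fun l => algebraMap (MvPolynomial (Fin 4) k) (Localization.Away (hh i)) (X ((![0, 1, 2] : Fin 3 → Fin 4) l))) ((![(![9, 2, 3] : Fin 3 → ℕ), (![3, 1, 2] : Fin 3 → ℕ)] : Fin 2 → (Fin 3 → ℕ)) i)) (ChartRing (𝒜u i) (fun l => algebraMap (MvPolynomial (Fin 4) k) (Localization.Away (hh i)) (X ((![0, 1, 2] : Fin 3 → Fin 4) l))) ((![(![9, 2, 3] : Fin 3 → ℕ), (![3, 1, 2] : Fin 3 → ℕ)] : Fin 2 → (Fin 3 → ℕ)) i)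 (D * (p * 18)) (y i j) (hy i j)) (algebraMap (Localization.Away (hh i)) ↥(cobordantAlgebra (fun l => algebraMap (MvPolynomial (Fin 4) k) (Localization.Away (hh i)) (X ((![0, 1, 2] : Fin 3 → Fin 4) l))) ((![(![9, 2, 3] : Fin 3 → ℕ), (![3, 1, 2] : Fin 3 → ℕ)] : Fin 2 → (Fin 3 → ℕ)) i)) ((fun l => algebraMap (MvPolynomial (Fin 4) k) (Localization.Away (hh i)) (X ((![0, 1, 2] : Fin 3 → Fin 4) l))) 0)) := fun i j => by
    rw [hr0d, hEval i j, heI, e₀.apply_symm_apply, hγ0]; rfl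
  have hrxi : ∀ i j, letI := chartNodeGradedRing ![] (𝒜u i) (fun l => algebraMap (MvPolynomial (Fin 4) k) (Localization.Away (hh i)) (X ((![0, 1, 2] : Fin 3 → Fin 4) l))) ((![(![9, 2, 3] : Fin 3 → ℕ), (![3, 1, 2] : Fin 3 → ℕ)] : Fin 2 → (Fin 3 → ℕ)) i) (hfA i) (D * (p * 18)) (y i j) (hy i j); ((E i j (rxi i j) : ↥((chartNodeGrading ![] (𝒜u i) (fun l => algebraMap (MvPolynomial (Fin 4) k) (Localization.Away (hh i)) (X ((![0, 1, 2] : Fin 3 → Fin 4) l))) ((![(![9, 2, 3] : Fin 3 → ℕ), (![3, 1, 2] : Fin 3 → ℕ)] : Fin 2 → (Fin 3 → ℕ)) i) (hfA i) (D * (p * 18)) (y i j) (hy i j)) 0)) : (ChartRing (𝒜u i) (fun l => algebraMap (MvPolynomial (Fin 4) k) (Localization.Away (hh i)) (X ((![0, 1, 2] : Fin 3 → Fin 4) l))) ((![(![9, 2, 3] : Fin 3 → ℕ), (![3, 1, 2] : Fin 3 → ℕ)] : Fin 2 → (Fin 3 → ℕ)) i) (D * (p * 18)) (y i j) (hy i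 j))) = algebraMap ↥(cobordantAlgebra (fun l => algebraMap (MvPolynomial (Fin 4) k) (Localization.Away (hh i)) (X ((![0, 1, 2] : Fin 3 → Fin 4) l))) ((![(![9, 2, 3] : Fin 3 → ℕ), (![3, 1, 2] : Fin 3 → ℕ)] : Fin 2 → (Fin 3 → ℕ)) i)) (ChartRing (𝒜u i) (fun l => algebraMap (MvPolynomial (Fin 4) k) (Localization.Away (hh i)) (X ((![0, 1, 2] : Fin 3 → Fin 4) l))) ((![(![9, 2, 3] : Fin 3 → ℕ), (![3, 1, 2] : Fin 3 → ℕ)] : Fin 2 → (Fin 3 → ℕ)) i) (D * (p * 18)) (y i j) (hy i j)) (algebraMap (Localization.Away (hh i)) ↥(cobordantAlgebra (fun l => algebraMap (MvPolynomial (Fin 4) k) (Localization.Away (hh i)) (X ((![0, 1, 2] : Fin 3 → Fin 4) l))) ((![(![9, 2, 3] : Fin 3 → ℕ), (![3, 1, 2] : Fin 3 → ℕ)] : Fin 2 → (Fin 3 → ℕ)) i)) (algebraMap (MvPolynomial (Fin 4) k) (Localization.Away (hh i)) ((![(2 * X 2 - 3 * X 1 ^ 2 : MvPolynomial (Fin 4)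 k), (2 * X 2 + C (2 * (1 - 3 * a)) * X 1 - 3 * X 1 ^ 2 : MvPolynomial (Fin 4) k)] : Fin 2 → (MvPolynomial (Fin 4) k)) i))) := fun i j => by
    rw [hrxid, hEval i j, heI, e₀.apply_symm_apply, hγξ]
  have hrt : ∀ i j, letI := chartNodeGradedRing ![] (𝒜u i) (fun l => algebraMap (MvPolynomial (Fin 4) k) (Localization.Away (hh i)) (X ((![0, 1, 2] : Fin 3 → Fin 4) l))) ((![(![9, 2, 3] : Fin 3 → ℕ), (![3, 1, 2] : Fin 3 → ℕ)] : Fin 2 → (Fin 3 → ℕ)) i) (hfA i) (D * (p * 18)) (y i j) (hy i j); ((E i j (rt i j) : ↥((chartNodeGrading ![] (𝒜u i) (fun l => algebraMap (MvPolynomial (Fin 4) k) (Localization.Away (hh i)) (X ((![0, 1, 2] : Fin 3 → Fin 4) l))) ((![(![9, 2, 3] : Fin 3 → ℕ), (![3, 1, 2] : Fin 3 → ℕ)] : Fin 2 → (Fin 3 → ℕ)) i) (hfA i) (D * (p * 18)) (y i j) (hy i j)) 0)) : (ChartRing (𝒜u i) (fun l => algebraMap (MvPolynomial (Fin 4) k)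 (Localization.Away (hh i)) (X ((![0, 1, 2] : Fin 3 → Fin 4) l))) ((![(![9, 2, 3] : Fin 3 → ℕ), (![3, 1, 2] : Fin 3 → ℕ)] : Fin 2 → (Fin 3 → ℕ)) i) (D * (p * 18)) (y i j) (hy i j))) = algebraMap ↥(cobordantAlgebra (fun l => algebraMap (MvPolynomial (Fin 4) k) (Localization.Away (hh i)) (X ((![0, 1, 2] : Fin 3 → Fin 4) l))) ((![(![9, 2, 3] : Fin 3 → ℕ), (![3, 1, 2] : Fin 3 → ℕ)] : Fin 2 → (Fin 3 → ℕ)) i)) (ChartRing (𝒜u i) (fun l => algebraMap (MvPolynomial (Fin 4) k) (Localization.Away (hh i)) (X ((![0, 1, 2] : Fin 3 → Fin 4) l))) ((![(![9, 2, 3] : Fin 3 → ℕ), (![3, 1, 2] : Fin 3 → ℕ)] : Fin 2 → (Fin 3 → ℕ)) i) (D * (p * 18)) (y i j) (hy i j)) (algebraMap (Localization.Away (hh i)) ↥(cobordantAlgebra (fun l => algebraMap (MvPolynomial (Fin 4) k) (Localization.Away (hh i)) (X ((![0, 1, 2] : Fin 3 → Fin 4) l))) ((![(![9, 2, 3] :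 Fin 3 → ℕ), (![3, 1, 2] : Fin 3 → ℕ)] : Fin 2 → (Fin 3 → ℕ)) i)) (algebraMap (MvPolynomial (Fin 4) k) (Localization.Away (hh i)) ((![(X 2 ^ 2 - X 1 ^ 3 : MvPolynomial (Fin 4) k), (X 2 ^ 2 + 2 * X 1 * X 2 + C (2 * c) * X 2 + C (1 - 3 * a) * X 1 ^ 2 - X 1 ^ 3 : MvPolynomial (Fin 4) k)] : Fin 2 → (MvPolynomial (Fin 4) k)) i))) := fun i j => by
    rw [hrtd, hEval i j, heI, e₀.apply_symm_apply, hγf]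
  have hhhO : hh 0 = ∏ l : ZMod p, (X 1 + C (-a) + (l.val : (MvPolynomial (Fin 4) k)) * X 0) := by
    rw [hhh 0, show Finset.univ.erase (0 : Fin 2) = {1} from by decide, Finset.prod_singleton]
    simp only [Fin.isValue, Matrix.cons_val_zero, Matrix.cons_val_one, zero_sub]
  have hhhQ : hh 1 = ∏ l : ZMod p, (X 1 + C a + (l.val : (MvPolynomial (Fin 4) k)) * X 0) := by
    rw [hhh 1, show Finset.univ.erase (1 : Fin 2) = {0} from by decide, Finset.prod_singleton]
    simp only [Fin.isValue, Matrix.cons_val_zero, Matrix.cons_val_one, sub_zero]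
  have hDBpos : 0 < (D * (p * 18)) := Nat.mul_pos hD hkk; have hmemO := exists_cuspO_memberChart_rel_xi_units (p := p) hG (σI 0) (hCI 0) (h0I 0) (h1I 0) (h2I 0) (h3I 0) a ha hk2 (hh 0) hhhO (hσh 0) hp.pos (hσpL 0) (hσJ 0) (ht 0) ![] (𝒜u 0) (hfull 0) (hfA 0) (y 0 1) (hy 0 1) (hσy 0 1) (hcov1 0) hDBpos M₁ (OW 0 1) (hOWaff 0 1) (E 0 1) (htame' 0 1) (hE' 0 1) (r0 0 1) (rxi 0 1) (rt 0 1) (hr0 0 1) (hrxi 0 1) (hrt 0 1) (letI := chartNodeGradedRing ![] (𝒜u 0) (fun l => algebraMap (MvPolynomial (Fin 4) k) (Localization.Away (hh 0)) (X ((![0, 1, 2] : Fin 3 → Fin 4) l))) ((![(![9, 2, 3] : Fin 3 → ℕ), (![3, 1, 2] : Fin 3 → ℕ)] : Fin 2 → (Fin 3 → ℕ)) 0) (hfA 0) (D * (p * 18)) (y 0 1) (hy 0 1); (E 0 1).symm ⟨_, (hres 0 1).1⟩) (letI := chartNodeGradedRing ![] (𝒜u 0) (fun l => algebraMap (MvPolynomial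 (Fin 4) k) (Localization.Away (hh 0)) (X ((![0, 1, 2] : Fin 3 → Fin 4) l))) ((![(![9, 2, 3] : Fin 3 → ℕ), (![3, 1, 2] : Fin 3 → ℕ)] : Fin 2 → (Fin 3 → ℕ)) 0) (hfA 0) (D * (p * 18)) (y 0 1) (hy 0 1); (E 0 1).symm ⟨_, (hresT 0 1).1⟩) (hn₀ 0) (hnT 0) (by letI := chartNodeGradedRing ![] (𝒜u 0) (fun l => algebraMap (MvPolynomial (Fin 4) k) (Localization.Away (hh 0)) (X ((![0, 1, 2] : Fin 3 → Fin 4) l))) ((![(![9, 2, 3] : Fin 3 → ℕ), (![3, 1, 2] : Fin 3 → ℕ)] : Fin 2 → (Fin 3 → ℕ)) 0) (hfA 0) (D * (p * 18)) (y 0 1) (hy 0 1); exact congrArg Subtype.val ((E 0 1).apply_symm_apply _)) (by letI := chartNodeGradedRing ![] (𝒜u 0) (fun l => algebraMap (MvPolynomial (Fin 4) k) (Localization.Away (hh 0)) (X ((![0, 1, 2] : Fin 3 → Fin 4) l))) ((![(![9, 2, 3] : Fin 3 → ℕ), (![3, 1, 2] : Fin 3 → ℕ)] : Fin 2 → (Fin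 3 → ℕ)) 0) (hfA 0) (D * (p * 18)) (y 0 1) (hy 0 1); exact congrArg Subtype.val ((E 0 1).apply_symm_apply _))
  obtain ⟨bO, UO, hUOW, hUOb, hbO, aO, bbO, hrelaO, hrelbO, huaO, hubO, dO, hdOpos, hKO⟩ := hmemO; have hmemQ := exists_cuspQ_memberChart_rel_units (p := p) hG (σI 1) (hCI 1) a c ha hc0 hQ1 hQ2 hk2 he0 (h0I 1) (h1I 1) (h2I 1) (h3I 1) (hh 1) hhhQ (hσh 1) hp.pos (hσpL 1) (hσJ 1) (ht 1) ![] (𝒜u 1) (hfull 1) (hfA 1) (y 1 1) (hy 1 1) (hσy 1 1) (hcov1 1) hDBpos M₁ (OW 1 1) (hOWaff 1 1) (E 1 1) (htame' 1 1) (hE' 1 1) (r0 1 1) (rxi 1 1) (rt 1 1) (hr0 1 1) (hrxi 1 1) (hrt 1 1) (letI := chartNodeGradedRing ![] (𝒜u 1) (fun l => algebraMap (MvPolynomial (Fin 4) k) (Localization.Away (hh 1)) (X ((![0, 1, 2] : Fin 3 → Fin 4) l))) ((![(![9, 2, 3] : Fin 3 → ℕ), (![3, 1, 2] : Fin 3 →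 ℕ)] : Fin 2 → (Fin 3 → ℕ)) 1) (hfA 1) (D * (p * 18)) (y 1 1) (hy 1 1); (E 1 1).symm ⟨_, (hres 1 1).1⟩) (letI := chartNodeGradedRing ![] (𝒜u 1) (fun l => algebraMap (MvPolynomial (Fin 4) k) (Localization.Away (hh 1)) (X ((![0, 1, 2] : Fin 3 → Fin 4) l))) ((![(![9, 2, 3] : Fin 3 → ℕ), (![3, 1, 2] : Fin 3 → ℕ)] : Fin 2 → (Fin 3 → ℕ)) 1) (hfA 1) (D * (p * 18)) (y 1 1) (hy 1 1); (E 1 1).symm ⟨_, (hresT 1 1).1⟩) (hn₀ 1) (hnT 1) (by letI := chartNodeGradedRing ![] (𝒜u 1) (fun l => algebraMap (MvPolynomial (Fin 4) k) (Localization.Away (hh 1)) (X ((![0, 1, 2] : Fin 3 → Fin 4) l))) ((![(![9, 2, 3] : Fin 3 → ℕ), (![3, 1, 2] : Fin 3 → ℕ)] : Fin 2 → (Fin 3 → ℕ)) 1) (hfA 1) (D * (p * 18)) (y 1 1) (hy 1 1); exact congrArg Subtype.val ((E 1 1).apply_symm_apply _)) (by letI := chartNodeGradedRing ![] (𝒜u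 1) (fun l => algebraMap (MvPolynomial (Fin 4) k) (Localization.Away (hh 1)) (X ((![0, 1, 2] : Fin 3 → Fin 4) l))) ((![(![9, 2, 3] : Fin 3 → ℕ), (![3, 1, 2] : Fin 3 → ℕ)] : Fin 2 → (Fin 3 → ℕ)) 1) (hfA 1) (D * (p * 18)) (y 1 1) (hy 1 1); exact congrArg Subtype.val ((E 1 1).apply_symm_apply _))
  obtain ⟨bQ, UQ, hUQW, hUQb, hbQ, aQ, bbQ, hrelaQ, hrelbQ, huaQ, hubQ, dQ, hdQpos, hKQ⟩ := hmemQ; have hc1v : ((coverElement (𝒜u 1) (fun l => algebraMap (MvPolynomial (Fin 4) k) (Localization.Away (hh 1)) (X ((![0, 1, 2] : Fin 3 → Fin 4) l))) ((![(![9, 2, 3] : Fin 3 → ℕ), (![3, 1, 2] : Fin 3 → ℕ)] : Fin 2 → (Fin 3 → ℕ)) 1) (D * (p * 18))) (y 1 2) (hy 1 2)) = cobordantAlgebra.u' (fun l => algebraMap (MvPolynomial (Fin 4) k) (Localization.Away (hh 1)) (X ((![0, 1, 2] : Fin 3 → Fin 4) l))) ((![(![9, 2, 3] : Fin 3 → ℕ),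 (![3, 1, 2] : Fin 3 → ℕ)] : Fin 2 → (Fin 3 → ℕ)) 1) 2 ^ (p * ((![6 * D, 9 * D] : Fin 2 → ℕ) 1)) := by
    have h12 := hcov2 1; rw [show ((![1, 0] : Fin 2 → ℕ) 1) = 0 from rfl, Nat.cast_zero] at h12; simp only [zero_mul, map_zero, add_zero, Finset.prod_const, Finset.card_univ, ZMod.card, ← pow_mul] at h12; exact h12
  have hmemQv := exists_cuspQv_memberChart_rel_units (p := p) hG (σI 1) (hCI 1) a c ha hc0 hQ1 hQ2 hk2 he0 (h0I 1) (h1I 1) (h2I 1) (h3I 1) (hh 1) hhhQ (hσh 1) hp.pos (hσpL 1) (hσJ 1) (ht 1) ![] (𝒜u 1) (hfull 1) (hfA 1) (y 1 2) (hy 1 2) (hσy 1 2) hc1v hDBpos M₁ (OW 1 2) (hOWaff 1 2) (E 1 2) (htame' 1 2) (hE' 1 2) (r0 1 2) (rxi 1 2) (rt 1 2) (hr0 1 2) (hrxi 1 2) (hrt 1 2) (letI := chartNodeGradedRing ![] (𝒜u 1) (fun l => algebraMap (MvPolynomial (Fin 4) k) (Localization.Away (hh 1)) (X ((![0, 1,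 2] : Fin 3 → Fin 4) l))) ((![(![9, 2, 3] : Fin 3 → ℕ), (![3, 1, 2] : Fin 3 → ℕ)] : Fin 2 → (Fin 3 → ℕ)) 1) (hfA 1) (D * (p * 18)) (y 1 2) (hy 1 2); (E 1 2).symm ⟨_, (hres 1 2).1⟩) (letI := chartNodeGradedRing ![] (𝒜u 1) (fun l => algebraMap (MvPolynomial (Fin 4) k) (Localization.Away (hh 1)) (X ((![0, 1, 2] : Fin 3 → Fin 4) l))) ((![(![9, 2, 3] : Fin 3 → ℕ), (![3, 1, 2] : Fin 3 → ℕ)] : Fin 2 → (Fin 3 → ℕ)) 1) (hfA 1) (D * (p * 18)) (y 1 2) (hy 1 2); (E 1 2).symm ⟨_, (hresT 1 2).1⟩) (hn₀ 1) (hnT 1) (by letI := chartNodeGradedRing ![] (𝒜u 1) (fun l => algebraMap (MvPolynomial (Fin 4) k) (Localization.Away (hh 1)) (X ((![0, 1, 2] : Fin 3 → Fin 4) l))) ((![(![9, 2, 3] : Fin 3 → ℕ), (![3, 1, 2] : Fin 3 → ℕ)] : Fin 2 → (Fin 3 → ℕ)) 1) (hfA 1) (D * (p * 18)) (y 1 2)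 (hy 1 2); exact congrArg Subtype.val ((E 1 2).apply_symm_apply _)) (by letI := chartNodeGradedRing ![] (𝒜u 1) (fun l => algebraMap (MvPolynomial (Fin 4) k) (Localization.Away (hh 1)) (X ((![0, 1, 2] : Fin 3 → Fin 4) l))) ((![(![9, 2, 3] : Fin 3 → ℕ), (![3, 1, 2] : Fin 3 → ℕ)] : Fin 2 → (Fin 3 → ℕ)) 1) (hfA 1) (D * (p * 18)) (y 1 2) (hy 1 2); exact congrArg Subtype.val ((E 1 2).apply_symm_apply _))
  obtain ⟨bQv, UQv, hUQvW, hUQvb, hbQv, aQv, bbQv, hrelaQv, hrelbQv, huaQv, hubQv, dQv, hdQvpos, hKQv⟩ := hmemQv; have hnotsupp : ∀ i k', k' ≠ i → ∀ v : M₁.V, π₁.base v ∈ (basicOpenStable (GModel.initial (p := p) (g₀ := g₀) hq h₀).act O hO (actO_symm_eq_of_fixed hG (GModel.initial (p := p) (g₀ := g₀) hq h₀) O (eI i) (σI i) (hactI i) (hh i) (hσh i))).1 → π₁.base v ∈ (basicOpenStable (GModel.initial (p := p) (g₀ := g₀) hq h₀).act O hO (actO_symm_eq_of_fixed hG (GModel.initial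 (p := p) (g₀ := g₀) hq h₀) O (eI k') (σI k') (hactI k') (hh k') (hσh k'))).1 → π₁.base v ∉ ((((infRees 𝒦).ideal D ^ (p * 18))).support : Set (GModel.initial (p := p) (g₀ := g₀) hq h₀).V) := by
    intro i k' hk v hvi hvk hvs; rw [Scheme.IdealSheafData.support_pow _ _ hkk.ne'] at hvs; obtain ⟨j, hj⟩ := Set.mem_iUnion.mp (MultiRoot.support_infRees_subset 𝒦 D hvs); by_cases hji : j = i
    · exact Set.disjoint_left.mp (hWoff k' i (Ne.symm hk)) hvk (hji ▸ hj)
    · exact Set.disjoint_left.mp (hWoff i j hji) hvi hj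
  have hX0sec : ∀ i, (eW i).symm ⟨_, hfull0 i ((fun l => algebraMap (MvPolynomial (Fin 4) k) (Localization.Away (hh i)) (X ((![0, 1, 2] : Fin 3 → Fin 4) l))) 0 ^ ((![2 * D * p, 6 * D * p] : Fin 2 → ℕ) i))⟩ = (((GModel.initial (p := p) (g₀ := g₀) hq h₀).V.presheaf.map (homOfLE (hWO i)).op).hom (e₀.symm (X 0))) ^ ((![2 * D * p, 6 * D * p] : Fin 2 → ℕ) i) := fun i => by
    have h1 : (((GModel.initial (p := p) (g₀ := g₀) hq h₀).V.presheaf.map (homOfLE (hWO i)).op).hom (e₀.symm (X 0))) = sW i (e₀.symm (X 0)) := by rw [hsW]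
    rw [h1]; exact (eW i).injective (Subtype.ext (by rw [(eW i).apply_symm_apply, map_pow, SetLike.GradeZero.coe_pow, hpinW' i, heI, e₀.apply_symm_apply, hγ0]; try rfl))
  have hFsec : ∀ i, (eW i).symm ⟨_, hfull0 i ((algebraMap (MvPolynomial (Fin 4) k) (Localization.Away (hh i)) ((![(X 2 ^ 2 - X 1 ^ 3 : MvPolynomial (Fin 4) k), (X 2 ^ 2 + 2 * X 1 * X 2 + C (2 * c) * X 2 + C (1 - 3 * a) * X 1 ^ 2 - X 1 ^ 3 : MvPolynomial (Fin 4) k)] : Fin 2 → (MvPolynomial (Fin 4) k)) i)) ^ ((![3 * D * p, 9 * D * p] : Fin 2 → ℕ) i))⟩ = (((GModel.initial (p := p) (g₀ := g₀) hq h₀).V.presheaf.map (homOfLE (hWO i)).op).hom (e₀.symm fO)) ^ ((![3 * D * p, 9 * D * p] : Fin 2 → ℕ) i) := fun i => by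
    have h1 : (((GModel.initial (p := p) (g₀ := g₀) hq h₀).V.presheaf.map (homOfLE (hWO i)).op).hom (e₀.symm fO)) = sW i (e₀.symm fO) := by rw [hsW]
    rw [h1]; exact (eW i).injective (Subtype.ext (by rw [(eW i).apply_symm_apply, map_pow, SetLike.GradeZero.coe_pow, hpinW' i, heI, e₀.apply_symm_apply, hγf]; try rfl))
  have hZ0pin : ∀ i j, letI := chartNodeGradedRing ![] (𝒜u i) (fun l => algebraMap (MvPolynomial (Fin 4) k) (Localization.Away (hh i)) (X ((![0, 1, 2] : Fin 3 → Fin 4) l))) ((![(![9, 2, 3] : Fin 3 → ℕ), (![3, 1, 2] : Fin 3 → ℕ)] : Fin 2 → (Fin 3 → ℕ)) i) (hfA i) (D * (p * 18)) (y i j) (hy i j); (letI := chartNodeGradedRing ![] (𝒜u i) (fun l => algebraMap (MvPolynomial (Fin 4) k) (Localization.Away (hh i)) (X ((![0, 1, 2] : Fin 3 → Fin 4) l))) ((![(![9, 2, 3] : Fin 3 → ℕ), (![3, 1, 2] : Fin 3 → ℕ)] : Fin 2 → (Fin 3 → ℕ)) i) (hfA i) (D * (p * 18)) (y i j) (hy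 i j); (E i j).symm ⟨_, (hres i j).1⟩) * π₁.appLE (basicOpenStable (GModel.initial (p := p) (g₀ := g₀) hq h₀).act O hO (actO_symm_eq_of_fixed hG (GModel.initial (p := p) (g₀ := g₀) hq h₀) O (eI i) (σI i) (hactI i) (hh i) (hσh i))).1 (OW i j).1 (hWle₁ i j) ((eW i).symm (y i j)) = π₁.appLE (basicOpenStable (GModel.initial (p := p) (g₀ := g₀) hq h₀).act O hO (actO_symm_eq_of_fixed hG (GModel.initial (p := p) (g₀ := g₀) hq h₀) O (eI i) (σI i) (hactI i) (hh i) (hσh i))).1 (OW i j).1 (hWle₁ i j) ((((GModel.initial (p := p) (g₀ := g₀) hq h₀).V.presheaf.map (homOfLE (hWO i)).op).hom (e₀.symm (X 0))) ^ ((![2 * D * p, 6 * D * p] : Fin 2 → ℕ) i)) := by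
    intro i j; letI := chartNodeGradedRing ![] (𝒜u i) (fun l => algebraMap (MvPolynomial (Fin 4) k) (Localization.Away (hh i)) (X ((![0, 1, 2] : Fin 3 → Fin 4) l))) ((![(![9, 2, 3] : Fin 3 → ℕ), (![3, 1, 2] : Fin 3 → ℕ)] : Fin 2 → (Fin 3 → ℕ)) i) (hfA i) (D * (p * 18)) (y i j) (hy i j); rw [← hX0sec i]; exact symm_mul_appLE_eq_of_pin π₁ (basicOpenStable (GModel.initial (p := p) (g₀ := g₀) hq h₀).act O hO (actO_symm_eq_of_fixed hG (GModel.initial (p := p) (g₀ := g₀) hq h₀) O (eI i) (σI i) (hactI i) (hh i) (hσh i))).1 (OW i j).1 (hWle₁ i j) (chartNodeGrading ![] (𝒜u i) (fun l => algebraMap (MvPolynomial (Fin 4) k) (Localization.Away (hh i)) (X ((![0, 1, 2] : Fin 3 → Fin 4) l))) ((![(![9, 2, 3] : Fin 3 → ℕ), (![3, 1, 2] : Fin 3 → ℕ)] : Fin 2 → (Fin 3 → ℕ)) i) (hfA i) (D * (p * 18)) (y i j) (hy i j)) (E i j) (eW i) (toChartRing (𝒜u i) (fun l => algebraMap (MvPolynomial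 (Fin 4) k) (Localization.Away (hh i)) (X ((![0, 1, 2] : Fin 3 → Fin 4) l))) ((![(![9, 2, 3] : Fin 3 → ℕ), (![3, 1, 2] : Fin 3 → ℕ)] : Fin 2 → (Fin 3 → ℕ)) i) (D * (p * 18)) (y i j) (hy i j)) (hpin i j (hWle₁ i j)) ⟨_, (hres i j).1⟩ _ _ _ (y i j) ((eW i).apply_symm_apply _) ((eW i).apply_symm_apply _) (QhAbs.qha_residualSection_zero_pin (f := (fun l => algebraMap (MvPolynomial (Fin 4) k) (Localization.Away (hh i)) (X ((![0, 1, 2] : Fin 3 → Fin 4) l)))) (w := ((![(![9, 2, 3] : Fin 3 → ℕ), (![3, 1, 2] : Fin 3 → ℕ)] : Fin 2 → (Fin 3 → ℕ)) i)) (mo := ![]) (𝒜 := 𝒜u i) (y i j) (hy i j) ((![2 * D * p, 6 * D * p] : Fin 2 → ℕ) i) (hd₀ i) (hfull0 i _))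
  have hZ1pin : ∀ i j, letI := chartNodeGradedRing ![] (𝒜u i) (fun l => algebraMap (MvPolynomial (Fin 4) k) (Localization.Away (hh i)) (X ((![0, 1, 2] : Fin 3 → Fin 4) l))) ((![(![9, 2, 3] : Fin 3 → ℕ), (![3, 1, 2] : Fin 3 → ℕ)] : Fin 2 → (Fin 3 → ℕ)) i) (hfA i) (D * (p * 18)) (y i j) (hy i j); (letI := chartNodeGradedRing ![] (𝒜u i) (fun l => algebraMap (MvPolynomial (Fin 4) k) (Localization.Away (hh i)) (X ((![0, 1, 2] : Fin 3 → Fin 4) l))) ((![(![9, 2, 3] : Fin 3 → ℕ), (![3, 1, 2] : Fin 3 → ℕ)] : Fin 2 → (Fin 3 → ℕ)) i) (hfA i) (D * (p * 18)) (y i j) (hy i j); (E i j).symm ⟨_, (hresT i j).1⟩) * π₁.appLE (basicOpenStable (GModel.initial (p := p) (g₀ := g₀) hq h₀).act O hO (actO_symm_eq_of_fixed hG (GModel.initial (p := p) (g₀ := g₀) hq h₀) O (eI i) (σI i) (hactI i) (hh i) (hσh i))).1 (OW i j).1 (hWle₁ i j) ((eW i).symm (y i j)) = π₁.appLE (basicOpenStable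 (GModel.initial (p := p) (g₀ := g₀) hq h₀).act O hO (actO_symm_eq_of_fixed hG (GModel.initial (p := p) (g₀ := g₀) hq h₀) O (eI i) (σI i) (hactI i) (hh i) (hσh i))).1 (OW i j).1 (hWle₁ i j) ((((GModel.initial (p := p) (g₀ := g₀) hq h₀).V.presheaf.map (homOfLE (hWO i)).op).hom (e₀.symm fO)) ^ ((![3 * D * p, 9 * D * p] : Fin 2 → ℕ) i)) := by
    intro i j; letI := chartNodeGradedRing ![] (𝒜u i) (fun l => algebraMap (MvPolynomial (Fin 4) k) (Localization.Away (hh i)) (X ((![0, 1, 2] : Fin 3 → Fin 4) l))) ((![(![9, 2, 3] : Fin 3 → ℕ), (![3, 1, 2] : Fin 3 → ℕ)] : Fin 2 → (Fin 3 → ℕ)) i) (hfA i) (D * (p * 18)) (y i j) (hy i j); rw [← hFsec i]; exact symm_mul_appLE_eq_of_pin π₁ (basicOpenStable (GModel.initial (p := p) (g₀ := g₀) hq h₀).act O hO (actO_symm_eq_of_fixed hG (GModel.initial (p := p) (g₀ := g₀) hq h₀) O (eI i) (σI i) (hactI i) (hh i) (hσh i))).1 (OW i j).1 (hWle₁ i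 j) (chartNodeGrading ![] (𝒜u i) (fun l => algebraMap (MvPolynomial (Fin 4) k) (Localization.Away (hh i)) (X ((![0, 1, 2] : Fin 3 → Fin 4) l))) ((![(![9, 2, 3] : Fin 3 → ℕ), (![3, 1, 2] : Fin 3 → ℕ)] : Fin 2 → (Fin 3 → ℕ)) i) (hfA i) (D * (p * 18)) (y i j) (hy i j)) (E i j) (eW i) (toChartRing (𝒜u i) (fun l => algebraMap (MvPolynomial (Fin 4) k) (Localization.Away (hh i)) (X ((![0, 1, 2] : Fin 3 → Fin 4) l))) ((![(![9, 2, 3] : Fin 3 → ℕ), (![3, 1, 2] : Fin 3 → ℕ)] : Fin 2 → (Fin 3 → ℕ)) i) (D * (p * 18)) (y i j) (hy i j)) (hpin i j (hWle₁ i j)) ⟨_, (hresT i j).1⟩ _ _ _ (y i j) ((eW i).apply_symm_apply _) ((eW i).apply_symm_apply _) (QhAbs.qha_residualSection_tail_pin (f := (fun l => algebraMap (MvPolynomial (Fin 4) k) (Localization.Away (hh i)) (X ((![0, 1, 2] : Fin 3 → Fin 4) l)))) (t := algebraMap (MvPolynomial (Fin 4) k) (Localization.Away (hh i)) ((![(X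 2 ^ 2 - X 1 ^ 3 : MvPolynomial (Fin 4) k), (X 2 ^ 2 + 2 * X 1 * X 2 + C (2 * c) * X 2 + C (1 - 3 * a) * X 1 ^ 2 - X 1 ^ 3 : MvPolynomial (Fin 4) k)] : Fin 2 → (MvPolynomial (Fin 4) k)) i)) (w := ((![(![9, 2, 3] : Fin 3 → ℕ), (![3, 1, 2] : Fin 3 → ℕ)] : Fin 2 → (Fin 3 → ℕ)) i)) (sh := ((![6, 2] : Fin 2 → ℕ) i)) (ht := ht i) (mo := ![]) (𝒜 := 𝒜u i) (y i j) (hy i j) ((![3 * D * p, 9 * D * p] : Fin 2 → ℕ) i) (hdT i) (hfull0 i _))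
  have htrpin : ∀ i (j j' : Fin 3), letI := chartNodeGradedRing ![] (𝒜u i) (fun l => algebraMap (MvPolynomial (Fin 4) k) (Localization.Away (hh i)) (X ((![0, 1, 2] : Fin 3 → Fin 4) l))) ((![(![9, 2, 3] : Fin 3 → ℕ), (![3, 1, 2] : Fin 3 → ℕ)] : Fin 2 → (Fin 3 → ℕ)) i) (hfA i) (D * (p * 18)) (y i j) (hy i j); tr i j j' * π₁.appLE (basicOpenStable (GModel.initial (p := p) (g₀ := g₀) hq h₀).act O hO (actO_symm_eq_of_fixed hG (GModel.initial (p := p) (g₀ := g₀) hq h₀) O (eI i) (σI i) (hactI i) (hh i) (hσh i))).1 (OW i j).1 (hWle₁ i j) ((eW i).symm (y i j)) = π₁.appLE (basicOpenStable (GModel.initial (p := p) (g₀ := g₀) hq h₀).act O hO (actO_symm_eq_of_fixed hG (GModel.initial (p := p) (g₀ := g₀) hq h₀) O (eI i) (σI i) (hactI i) (hh i) (hσh i))).1 (OW i j).1 (hWle₁ i j) ((eW i).symm (y i j')) := by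
    intro i j j'; letI := chartNodeGradedRing ![] (𝒜u i) (fun l => algebraMap (MvPolynomial (Fin 4) k) (Localization.Away (hh i)) (X ((![0, 1, 2] : Fin 3 → Fin 4) l))) ((![(![9, 2, 3] : Fin 3 → ℕ), (![3, 1, 2] : Fin 3 → ℕ)] : Fin 2 → (Fin 3 → ℕ)) i) (hfA i) (D * (p * 18)) (y i j) (hy i j); have h := symm_mul_appLE_eq_of_pin π₁ (basicOpenStable (GModel.initial (p := p) (g₀ := g₀) hq h₀).act O hO (actO_symm_eq_of_fixed hG (GModel.initial (p := p) (g₀ := g₀) hq h₀) O (eI i) (σI i) (hactI i) (hh i) (hσh i))).1 (OW i j).1 (hWle₁ i j) (chartNodeGrading ![] (𝒜u i) (fun l => algebraMap (MvPolynomial (Fin 4) k) (Localization.Away (hh i)) (X ((![0, 1, 2] : Fin 3 → Fin 4) l))) ((![(![9, 2, 3] : Fin 3 → ℕ), (![3, 1, 2] : Fin 3 → ℕ)] : Fin 2 → (Fin 3 → ℕ)) i) (hfA i) (D * (p * 18)) (y i j) (hy i j)) (E i j) (eW i) (toChartRing (𝒜u i) (fun l => algebraMap (MvPolynomial (Fin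 4) k) (Localization.Away (hh i)) (X ((![0, 1, 2] : Fin 3 → Fin 4) l))) ((![(![9, 2, 3] : Fin 3 → ℕ), (![3, 1, 2] : Fin 3 → ℕ)] : Fin 2 → (Fin 3 → ℕ)) i) (D * (p * 18)) (y i j) (hy i j)) (hpin i j (hWle₁ i j)) (E i j (tr i j j')) _ _ (y i j') (y i j) ((eW i).apply_symm_apply _) ((eW i).apply_symm_apply _) (by rw [htrE i j j']; exact coverElement_section_pin ![] (𝒜u i) (fun l => algebraMap (MvPolynomial (Fin 4) k) (Localization.Away (hh i)) (X ((![0, 1, 2] : Fin 3 → Fin 4) l))) ((![(![9, 2, 3] : Fin 3 → ℕ), (![3, 1, 2] : Fin 3 → ℕ)] : Fin 2 → (Fin 3 → ℕ)) i) (y i j) (hy i j) (y i j') (hy i j'))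
    rwa [(E i j).symm_apply_apply] at h
  have hc2O := hcov2 0; rw [show ((![1, 0] : Fin 2 → ℕ) 0) = 1 from rfl, Nat.cast_one] at hc2O; simp only [one_mul] at hc2O; have hresid : ∀ (i : Fin 2) (j : Fin 3), ∀ x ∈ (OW i j).1, x ∉ M₁.V.basicOpen (letI := chartNodeGradedRing ![] (𝒜u i) (fun l => algebraMap (MvPolynomial (Fin 4) k) (Localization.Away (hh i)) (X ((![0, 1, 2] : Fin 3 → Fin 4) l))) ((![(![9, 2, 3] : Fin 3 → ℕ), (![3, 1, 2] : Fin 3 → ℕ)] : Fin 2 → (Fin 3 → ℕ)) i) (hfA i) (D * (p * 18)) (y i j) (hy i j); (E i j).symm ⟨_, (hres i j).1⟩) → x ∉ M₁.V.basicOpen (letI := chartNodeGradedRing ![] (𝒜u i) (fun l => algebraMap (MvPolynomial (Fin 4) k) (Localization.Away (hh i)) (X ((![0, 1, 2] : Fin 3 → Fin 4) l))) ((![(![9, 2, 3] : Fin 3 → ℕ), (![3, 1, 2] : Fin 3 → ℕ)] : Fin 2 → (Fin 3 → ℕ)) i) (hfA i) (D * (p * 18)) (y i j) (hy i j); (E i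 j).symm ⟨_, (hresT i j).1⟩) → x ∈ UO.1 ∨ x ∈ UQ.1 ∨ x ∈ UQv.1 := by
    intro i j x hj hz0 hz1; fin_cases i <;> fin_cases j
    · exact absurd (hz0W 0 x hj) hz0
    · exact Or.inl (by rw [hUOb]; exact KillCert.QhSym.cuspO_mem_basicOpen_of_residual (σI 0) (hCI 0) (h0I 0) (h1I 0) (h2I 0) (h3I 0) (hh 0) (hσh 0) hp.pos (hσpL 0) (hσJ 0) (ht 0) ![] (𝒜u 0) (hfA 0) (y 0 1) (hy 0 1) (hσy 0 1) hk3 a ha9 hhhO (hn₁ 0) (hcov1 0) (hOWaff 0 1) (E 0 1) bO hbO (hn₀ 0) (hnT 0) (hres 0 1).1 (hresT 0 1).1 hj hz0 hz1)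
    · have htr : x ∈ M₁.V.basicOpen (tr 0 2 1) := KillCert.QhSym.cuspO_mem_basicOpen_transition_of_residual (hh 0) (ht 0) ![] (𝒜u 0) (hfA 0) (y 0 2) (hy 0 2) (y 0 1) (hy 0 1) (hn₂ 0) (hcov1 0) hc2O (hOWaff 0 2) (E 0 2) (tr 0 2 1) (htrE 0 2 1) (hn₀ 0) (hnT 0) (hres 0 2).1 (hresT 0 2).1 hj hz0 hz1; have hx01 : x ∈ (OW 0 1).1 := by
        rw [hOWeq 0 1]; exact mem_blowupChart_of_mem_basicOpen_of_mul_appLE_eq ⟨(basicOpenStable (GModel.initial (p := p) (g₀ := g₀) hq h₀).act O hO (actO_symm_eq_of_fixed hG (GModel.initial (p := p) (g₀ := g₀) hq h₀) O (eI 0) (σI 0) (hactI 0) (hh 0) (hσh 0))).1, hWaff 0⟩ (le_of_eq (hOWeq 0 2)) (tr 0 2 1) (htrpin 0 2 1) hj htr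
      have hz0' : x ∉ M₁.V.basicOpen (letI := chartNodeGradedRing ![] (𝒜u 0) (fun l => algebraMap (MvPolynomial (Fin 4) k) (Localization.Away (hh 0)) (X ((![0, 1, 2] : Fin 3 → Fin 4) l))) ((![(![9, 2, 3] : Fin 3 → ℕ), (![3, 1, 2] : Fin 3 → ℕ)] : Fin 2 → (Fin 3 → ℕ)) 0) (hfA 0) (D * (p * 18)) (y 0 1) (hy 0 1); (E 0 1).symm ⟨_, (hres 0 1).1⟩) := fun h => hz0 ((mem_basicOpen_iff_of_pins hπ' ⟨(basicOpenStable (GModel.initial (p := p) (g₀ := g₀) hq h₀).act O hO (actO_symm_eq_of_fixed hG (GModel.initial (p := p) (g₀ := g₀) hq h₀) O (eI 0) (σI 0) (hactI 0) (hh 0) (hσh 0))).1, hWaff 0⟩ (hxJ 0 1) (hxJ 0 2) (le_of_eq (hOWeq 0 1)) (le_of_eq (hOWeq 0 2)) _ _ (hZ0pin 0 1) (hZ0pin 0 2) hx01 hj).mp h); have hz1' : x ∉ M₁.V.basicOpen (letI := chartNodeGradedRing ![] (𝒜u 0) (fun l => algebraMap (MvPolynomial (Fin 4) k) (Localization.Away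 (hh 0)) (X ((![0, 1, 2] : Fin 3 → Fin 4) l))) ((![(![9, 2, 3] : Fin 3 → ℕ), (![3, 1, 2] : Fin 3 → ℕ)] : Fin 2 → (Fin 3 → ℕ)) 0) (hfA 0) (D * (p * 18)) (y 0 1) (hy 0 1); (E 0 1).symm ⟨_, (hresT 0 1).1⟩) := fun h => hz1 ((mem_basicOpen_iff_of_pins hπ' ⟨(basicOpenStable (GModel.initial (p := p) (g₀ := g₀) hq h₀).act O hO (actO_symm_eq_of_fixed hG (GModel.initial (p := p) (g₀ := g₀) hq h₀) O (eI 0) (σI 0) (hactI 0) (hh 0) (hσh 0))).1, hWaff 0⟩ (hxJ 0 1) (hxJ 0 2) (le_of_eq (hOWeq 0 1)) (le_of_eq (hOWeq 0 2)) _ _ (hZ1pin 0 1) (hZ1pin 0 2) hx01 hj).mp h); exact Or.inl (by rw [hUOb]; exact KillCert.QhSym.cuspO_mem_basicOpen_of_residual (σI 0) (hCI 0) (h0I 0) (h1I 0) (h2I 0) (h3I 0) (hh 0) (hσh 0) hp.pos (hσpL 0) (hσJ 0) (ht 0) ![] (𝒜u 0) (hfA 0) (y 0 1) (hy 0 1)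 (hσy 0 1) hk3 a ha9 hhhO (hn₁ 0) (hcov1 0) (hOWaff 0 1) (E 0 1) bO hbO (hn₀ 0) (hnT 0) (hres 0 1).1 (hresT 0 1).1 hx01 hz0' hz1')
    · exact absurd (hz0W 1 x hj) hz0
    · exact Or.inr (Or.inl (by rw [hUQb]; exact KillCert.QhAway.cuspQ_mem_basicOpen_of_residual a c (σI 1) (hCI 1) (h0I 1) (h1I 1) (h2I 1) (h3I 1) (hh 1) (hσh 1) hp.pos (hσpL 1) (hσJ 1) (ht 1) ![] (𝒜u 1) (hfA 1) (y 1 1) (hy 1 1) (hσy 1 1) hk2 hk3 hc0 ha9 hQ1 hQ2 hhhQ (hn₁ 1) (hcov1 1) (hOWaff 1 1) (E 1 1) bQ hbQ (hn₀ 1) (hnT 1) (hres 1 1).1 (hresT 1 1).1 hj hz0 hz1))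
    · exact Or.inr (Or.inr (by rw [hUQvb]; exact KillCert.QhAway.cuspQv_mem_basicOpen_of_residual a c (σI 1) (hCI 1) (h0I 1) (h1I 1) (h2I 1) (h3I 1) (hh 1) (hσh 1) hp.pos (hσpL 1) (hσJ 1) (ht 1) ![] (𝒜u 1) (hfA 1) (y 1 2) (hy 1 2) (hσy 1 2) hk2 hk3 hc0 ha9 hQ1 hQ2 hhhQ (Nat.mul_pos hp.pos (hn₂ 1)) hc1v (hOWaff 1 2) (E 1 2) bQv hbQv (hn₀ 1) (hnT 1) (hres 1 2).1 (hresT 1 2).1 hj hz0 hz1))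
  have hξO0 : ξO ≠ 0 := fun h => hk2 (by
    have h' := congrArg (MvPolynomial.eval (![0, 0, 1, 0] : Fin 4 → k)) h; simpa [hξO] using h')
  have hξO0' : e₀.symm ξO ≠ 0 := fun h => hξO0 (by simpa using congrArg e₀ h)
  have hζ : (π₁.appLE O.1 ⊤ htop (e₀.symm ξO)) ≠ 0 := GModel.appLE_top_ne_zero_of_eq_comp_id M₁ hπM O.1 htop hξO0'; have hrζ₀ : rxi 0 1 = (M₁.V.presheaf.map (homOfLE (le_top : (OW 0 1).1 ≤ ⊤)).op).hom (π₁.appLE O.1 ⊤ htop (e₀.symm ξO)) := by rw [happ, hrxid]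
  have hrz₀ : r0 0 1 = (M₁.V.presheaf.map (homOfLE (le_top : (OW 0 1).1 ≤ ⊤)).op).hom (π₁.appLE O.1 ⊤ htop (e₀.symm (X 0))) := by rw [happ, hr0d]
  have hrf₀ : rt 0 1 = (M₁.V.presheaf.map (homOfLE (le_top : (OW 0 1).1 ≤ ⊤)).op).hom (π₁.appLE O.1 ⊤ htop (e₀.symm fO)) := by rw [happ, hrtd]
  have hrζ₁ : rxi 1 1 = (M₁.V.presheaf.map (homOfLE (le_top : (OW 1 1).1 ≤ ⊤)).op).hom (π₁.appLE O.1 ⊤ htop (e₀.symm ξO)) := by rw [happ, hrxid]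
  have hrz₁ : r0 1 1 = (M₁.V.presheaf.map (homOfLE (le_top : (OW 1 1).1 ≤ ⊤)).op).hom (π₁.appLE O.1 ⊤ htop (e₀.symm (X 0))) := by rw [happ, hr0d]
  have hrf₁ : rt 1 1 = (M₁.V.presheaf.map (homOfLE (le_top : (OW 1 1).1 ≤ ⊤)).op).hom (π₁.appLE O.1 ⊤ htop (e₀.symm fO)) := by rw [happ, hrtd]
  have hrζ₂ : rxi 1 2 = (M₁.V.presheaf.map (homOfLE (le_top : (OW 1 2).1 ≤ ⊤)).op).hom (π₁.appLE O.1 ⊤ htop (e₀.symm ξO)) := by rw [happ, hrxid]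
  have hrz₂ : r0 1 2 = (M₁.V.presheaf.map (homOfLE (le_top : (OW 1 2).1 ≤ ⊤)).op).hom (π₁.appLE O.1 ⊤ htop (e₀.symm (X 0))) := by rw [happ, hr0d]
  have hrf₂ : rt 1 2 = (M₁.V.presheaf.map (homOfLE (le_top : (OW 1 2).1 ≤ ⊤)).op).hom (π₁.appLE O.1 ⊤ htop (e₀.symm fO)) := by rw [happ, hrtd]
  refine killsIn_one_of_threeCharts_global hp hG φ M₁ 𝔄₁ (π₁.appLE O.1 ⊤ htop (e₀.symm ξO)) (π₁.appLE O.1 ⊤ htop (e₀.symm (X 0))) (π₁.appLE O.1 ⊤ htop (e₀.symm fO)) hζ 3 2 ![2, 1] (fun l => by fin_cases l <;> norm_num) (OW 0 1).1 UO hUOW (rxi 0 1) (r0 0 1) (rt 0 1) hrζ₀ hrz₀ hrf₀ aO bbO hrelaO hrelbO ⟨dO, hdOpos, hKO⟩ (OW 1 1).1 UQ hUQW (rxi 1 1) (r0 1 1) (rt 1 1) hrζ₁ hrz₁ hrf₁ aQ bbQ hrelaQ hrelbQ ⟨dQ, hdQpos, hKQ⟩ (OW 1 2).1 UQv hUQvW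 (rxi 1 2) (r0 1 2) (rt 1 2) hrζ₂ hrz₂ hrf₂ aQv bbQv hrelaQv hrelbQv ⟨dQv, hdQvpos, hKQv⟩ (fun t : Fin 2 × Fin 3 => M₁.V.basicOpen (letI := chartNodeGradedRing ![] (𝒜u t.1) (fun l => algebraMap (MvPolynomial (Fin 4) k) (Localization.Away (hh t.1)) (X ((![0, 1, 2] : Fin 3 → Fin 4) l))) ((![(![9, 2, 3] : Fin 3 → ℕ), (![3, 1, 2] : Fin 3 → ℕ)] : Fin 2 → (Fin 3 → ℕ)) t.1) (hfA t.1) (D * (p * 18)) (y t.1 t.2) (hy t.1 t.2); (E t.1 t.2).symm ⟨_, (hres t.1 t.2).1⟩)) (fun t : Fin 2 × Fin 3 => M₁.V.basicOpen (letI := chartNodeGradedRing ![] (𝒜u t.1) (fun l => algebraMap (MvPolynomial (Fin 4) k) (Localization.Away (hh t.1)) (X ((![0, 1, 2] : Fin 3 → Fin 4) l))) ((![(![9, 2, 3] : Fin 3 → ℕ), (![3, 1, 2] : Fin 3 → ℕ)] : Fin 2 → (Fin 3 → ℕ)) t.1) (hfA t.1) (D * (p * 18)) (y t.1 t.2) (hy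 t.1 t.2); (E t.1 t.2).symm ⟨_, (hresT t.1 t.2).1⟩)) ?_ ?_ ?_ ?_ ?_ ?_ ?_ ?_
  · intro x; rcases hcovX (π₁.base x) with hX | ⟨i, hi⟩
    · refine Or.inr (Or.inr (Or.inr (Or.inl ?_))); rw [Scheme.basicOpen_appLE]; exact ⟨Set.mem_univ _, hX⟩
    · obtain ⟨j, hj⟩ := hcovM x i hi; by_cases hz0 : x ∈ M₁.V.basicOpen (letI := chartNodeGradedRing ![] (𝒜u i) (fun l => algebraMap (MvPolynomial (Fin 4) k) (Localization.Away (hh i)) (X ((![0, 1, 2] : Fin 3 → Fin 4) l))) ((![(![9, 2, 3] : Fin 3 → ℕ), (![3, 1, 2] : Fin 3 → ℕ)] : Fin 2 → (Fin 3 → ℕ)) i) (hfA i) (D * (p * 18)) (y i j) (hy i j); (E i j).symm ⟨_, (hres i j).1⟩)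
      · exact Or.inr (Or.inr (Or.inr (Or.inr (Or.inr (Or.inl ⟨(i, j), hz0⟩)))))
      · by_cases hz1 : x ∈ M₁.V.basicOpen (letI := chartNodeGradedRing ![] (𝒜u i) (fun l => algebraMap (MvPolynomial (Fin 4) k) (Localization.Away (hh i)) (X ((![0, 1, 2] : Fin 3 → Fin 4) l))) ((![(![9, 2, 3] : Fin 3 → ℕ), (![3, 1, 2] : Fin 3 → ℕ)] : Fin 2 → (Fin 3 → ℕ)) i) (hfA i) (D * (p * 18)) (y i j) (hy i j); (E i j).symm ⟨_, (hresT i j).1⟩)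
        · exact Or.inr (Or.inr (Or.inr (Or.inr (Or.inr (Or.inr ⟨(i, j), hz1⟩)))))
        · rcases hresid i j x hj hz0 hz1 with h | h | h
          · exact Or.inl h
          · exact Or.inr (Or.inl h)
          · exact Or.inr (Or.inr (Or.inl h))
  · rintro ⟨i', j'⟩ v hv hz; fin_cases i' <;> fin_cases j' <;> dsimp only at hz
    · exact huaO v hv ((mem_basicOpen_iff_of_pins hπ' ⟨(basicOpenStable (GModel.initial (p := p) (g₀ := g₀) hq h₀).act O hO (actO_symm_eq_of_fixed hG (GModel.initial (p := p) (g₀ := g₀) hq h₀) O (eI 0) (σI 0) (hactI 0) (hh 0) (hσh 0))).1, hWaff 0⟩ (hxJ 0 0) (hxJ 0 1) (le_of_eq (hOWeq 0 0)) (le_of_eq (hOWeq 0 1)) _ _ (hZ0pin 0 0) (hZ0pin 0 1) (M₁.V.basicOpen_le _ hz) (hUOW hv)).mp hz)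
    · exact huaO v hv hz
    · exact huaO v hv ((mem_basicOpen_iff_of_pins hπ' ⟨(basicOpenStable (GModel.initial (p := p) (g₀ := g₀) hq h₀).act O hO (actO_symm_eq_of_fixed hG (GModel.initial (p := p) (g₀ := g₀) hq h₀) O (eI 0) (σI 0) (hactI 0) (hh 0) (hσh 0))).1, hWaff 0⟩ (hxJ 0 2) (hxJ 0 1) (le_of_eq (hOWeq 0 2)) (le_of_eq (hOWeq 0 1)) _ _ (hZ0pin 0 2) (hZ0pin 0 1) (M₁.V.basicOpen_le _ hz) (hUOW hv)).mp hz)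
    · exact Scheme.mem_basicOpen_of_mul_eq_map hUOW hrz₀ hrelaO hv (mem_basicOpen_appLE_top_of_pin_pow_of_not_mem_support π₁ ((infRees 𝒦).ideal D ^ (p * 18)) ⟨(basicOpenStable (GModel.initial (p := p) (g₀ := g₀) hq h₀).act O hO (actO_symm_eq_of_fixed hG (GModel.initial (p := p) (g₀ := g₀) hq h₀) O (eI 1) (σI 1) (hactI 1) (hh 1) (hσh 1))).1, hWaff 1⟩ ((eW 1).symm (y 1 0)) (hWO 1) (e₀.symm (X 0)) (hn₀ 1) (le_of_eq (hOWeq 1 0)) (hWle₁ 1 0) _ (hZ0pin 1 0) (M₁.V.basicOpen_le _ hz) (hnotsupp 0 1 (by decide) v (hWle₁ 0 1 (hUOW hv)) (hWle₁ 1 0 (M₁.V.basicOpen_le _ hz))) hz htop)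
    · exact Scheme.mem_basicOpen_of_mul_eq_map hUOW hrz₀ hrelaO hv (mem_basicOpen_appLE_top_of_pin_pow_of_not_mem_support π₁ ((infRees 𝒦).ideal D ^ (p * 18)) ⟨(basicOpenStable (GModel.initial (p := p) (g₀ := g₀) hq h₀).act O hO (actO_symm_eq_of_fixed hG (GModel.initial (p := p) (g₀ := g₀) hq h₀) O (eI 1) (σI 1) (hactI 1) (hh 1) (hσh 1))).1, hWaff 1⟩ ((eW 1).symm (y 1 1)) (hWO 1) (e₀.symm (X 0)) (hn₀ 1) (le_of_eq (hOWeq 1 1)) (hWle₁ 1 1) _ (hZ0pin 1 1) (M₁.V.basicOpen_le _ hz) (hnotsupp 0 1 (by decide) v (hWle₁ 0 1 (hUOW hv)) (hWle₁ 1 1 (M₁.V.basicOpen_le _ hz))) hz htop)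
    · exact Scheme.mem_basicOpen_of_mul_eq_map hUOW hrz₀ hrelaO hv (mem_basicOpen_appLE_top_of_pin_pow_of_not_mem_support π₁ ((infRees 𝒦).ideal D ^ (p * 18)) ⟨(basicOpenStable (GModel.initial (p := p) (g₀ := g₀) hq h₀).act O hO (actO_symm_eq_of_fixed hG (GModel.initial (p := p) (g₀ := g₀) hq h₀) O (eI 1) (σI 1) (hactI 1) (hh 1) (hσh 1))).1, hWaff 1⟩ ((eW 1).symm (y 1 2)) (hWO 1) (e₀.symm (X 0)) (hn₀ 1) (le_of_eq (hOWeq 1 2)) (hWle₁ 1 2) _ (hZ0pin 1 2) (M₁.V.basicOpen_le _ hz) (hnotsupp 0 1 (by decide) v (hWle₁ 0 1 (hUOW hv)) (hWle₁ 1 2 (M₁.V.basicOpen_le _ hz))) hz htop)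
  · rintro ⟨i', j'⟩ v hv hz; fin_cases i' <;> fin_cases j' <;> dsimp only at hz
    · exact hubO v hv ((mem_basicOpen_iff_of_pins hπ' ⟨(basicOpenStable (GModel.initial (p := p) (g₀ := g₀) hq h₀).act O hO (actO_symm_eq_of_fixed hG (GModel.initial (p := p) (g₀ := g₀) hq h₀) O (eI 0) (σI 0) (hactI 0) (hh 0) (hσh 0))).1, hWaff 0⟩ (hxJ 0 0) (hxJ 0 1) (le_of_eq (hOWeq 0 0)) (le_of_eq (hOWeq 0 1)) _ _ (hZ1pin 0 0) (hZ1pin 0 1) (M₁.V.basicOpen_le _ hz) (hUOW hv)).mp hz)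
    · exact hubO v hv hz
    · exact hubO v hv ((mem_basicOpen_iff_of_pins hπ' ⟨(basicOpenStable (GModel.initial (p := p) (g₀ := g₀) hq h₀).act O hO (actO_symm_eq_of_fixed hG (GModel.initial (p := p) (g₀ := g₀) hq h₀) O (eI 0) (σI 0) (hactI 0) (hh 0) (hσh 0))).1, hWaff 0⟩ (hxJ 0 2) (hxJ 0 1) (le_of_eq (hOWeq 0 2)) (le_of_eq (hOWeq 0 1)) _ _ (hZ1pin 0 2) (hZ1pin 0 1) (M₁.V.basicOpen_le _ hz) (hUOW hv)).mp hz)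
    · exact Scheme.mem_basicOpen_of_mul_eq_map hUOW hrf₀ hrelbO hv (mem_basicOpen_appLE_top_of_pin_pow_of_not_mem_support π₁ ((infRees 𝒦).ideal D ^ (p * 18)) ⟨(basicOpenStable (GModel.initial (p := p) (g₀ := g₀) hq h₀).act O hO (actO_symm_eq_of_fixed hG (GModel.initial (p := p) (g₀ := g₀) hq h₀) O (eI 1) (σI 1) (hactI 1) (hh 1) (hσh 1))).1, hWaff 1⟩ ((eW 1).symm (y 1 0)) (hWO 1) (e₀.symm fO) (hnT 1) (le_of_eq (hOWeq 1 0)) (hWle₁ 1 0) _ (hZ1pin 1 0) (M₁.V.basicOpen_le _ hz) (hnotsupp 0 1 (by decide) v (hWle₁ 0 1 (hUOW hv)) (hWle₁ 1 0 (M₁.V.basicOpen_le _ hz))) hz htop)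
    · exact Scheme.mem_basicOpen_of_mul_eq_map hUOW hrf₀ hrelbO hv (mem_basicOpen_appLE_top_of_pin_pow_of_not_mem_support π₁ ((infRees 𝒦).ideal D ^ (p * 18)) ⟨(basicOpenStable (GModel.initial (p := p) (g₀ := g₀) hq h₀).act O hO (actO_symm_eq_of_fixed hG (GModel.initial (p := p) (g₀ := g₀) hq h₀) O (eI 1) (σI 1) (hactI 1) (hh 1) (hσh 1))).1, hWaff 1⟩ ((eW 1).symm (y 1 1)) (hWO 1) (e₀.symm fO) (hnT 1) (le_of_eq (hOWeq 1 1)) (hWle₁ 1 1) _ (hZ1pin 1 1) (M₁.V.basicOpen_le _ hz) (hnotsupp 0 1 (by decide) v (hWle₁ 0 1 (hUOW hv)) (hWle₁ 1 1 (M₁.V.basicOpen_le _ hz))) hz htop)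
    · exact Scheme.mem_basicOpen_of_mul_eq_map hUOW hrf₀ hrelbO hv (mem_basicOpen_appLE_top_of_pin_pow_of_not_mem_support π₁ ((infRees 𝒦).ideal D ^ (p * 18)) ⟨(basicOpenStable (GModel.initial (p := p) (g₀ := g₀) hq h₀).act O hO (actO_symm_eq_of_fixed hG (GModel.initial (p := p) (g₀ := g₀) hq h₀) O (eI 1) (σI 1) (hactI 1) (hh 1) (hσh 1))).1, hWaff 1⟩ ((eW 1).symm (y 1 2)) (hWO 1) (e₀.symm fO) (hnT 1) (le_of_eq (hOWeq 1 2)) (hWle₁ 1 2) _ (hZ1pin 1 2) (M₁.V.basicOpen_le _ hz) (hnotsupp 0 1 (by decide) v (hWle₁ 0 1 (hUOW hv)) (hWle₁ 1 2 (M₁.V.basicOpen_le _ hz))) hz htop)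
  · rintro ⟨i', j'⟩ v hv hz; fin_cases i' <;> fin_cases j' <;> dsimp only at hz
    · exact Scheme.mem_basicOpen_of_mul_eq_map hUQW hrz₁ hrelaQ hv (mem_basicOpen_appLE_top_of_pin_pow_of_not_mem_support π₁ ((infRees 𝒦).ideal D ^ (p * 18)) ⟨(basicOpenStable (GModel.initial (p := p) (g₀ := g₀) hq h₀).act O hO (actO_symm_eq_of_fixed hG (GModel.initial (p := p) (g₀ := g₀) hq h₀) O (eI 0) (σI 0) (hactI 0) (hh 0) (hσh 0))).1, hWaff 0⟩ ((eW 0).symm (y 0 0)) (hWO 0) (e₀.symm (X 0)) (hn₀ 0) (le_of_eq (hOWeq 0 0)) (hWle₁ 0 0) _ (hZ0pin 0 0) (M₁.V.basicOpen_le _ hz) (hnotsupp 1 0 (by decide) v (hWle₁ 1 1 (hUQW hv)) (hWle₁ 0 0 (M₁.V.basicOpen_le _ hz))) hz htop)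
    · exact Scheme.mem_basicOpen_of_mul_eq_map hUQW hrz₁ hrelaQ hv (mem_basicOpen_appLE_top_of_pin_pow_of_not_mem_support π₁ ((infRees 𝒦).ideal D ^ (p * 18)) ⟨(basicOpenStable (GModel.initial (p := p) (g₀ := g₀) hq h₀).act O hO (actO_symm_eq_of_fixed hG (GModel.initial (p := p) (g₀ := g₀) hq h₀) O (eI 0) (σI 0) (hactI 0) (hh 0) (hσh 0))).1, hWaff 0⟩ ((eW 0).symm (y 0 1)) (hWO 0) (e₀.symm (X 0)) (hn₀ 0) (le_of_eq (hOWeq 0 1)) (hWle₁ 0 1) _ (hZ0pin 0 1) (M₁.V.basicOpen_le _ hz) (hnotsupp 1 0 (by decide) v (hWle₁ 1 1 (hUQW hv)) (hWle₁ 0 1 (M₁.V.basicOpen_le _ hz))) hz htop)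
    · exact Scheme.mem_basicOpen_of_mul_eq_map hUQW hrz₁ hrelaQ hv (mem_basicOpen_appLE_top_of_pin_pow_of_not_mem_support π₁ ((infRees 𝒦).ideal D ^ (p * 18)) ⟨(basicOpenStable (GModel.initial (p := p) (g₀ := g₀) hq h₀).act O hO (actO_symm_eq_of_fixed hG (GModel.initial (p := p) (g₀ := g₀) hq h₀) O (eI 0) (σI 0) (hactI 0) (hh 0) (hσh 0))).1, hWaff 0⟩ ((eW 0).symm (y 0 2)) (hWO 0) (e₀.symm (X 0)) (hn₀ 0) (le_of_eq (hOWeq 0 2)) (hWle₁ 0 2) _ (hZ0pin 0 2) (M₁.V.basicOpen_le _ hz) (hnotsupp 1 0 (by decide) v (hWle₁ 1 1 (hUQW hv)) (hWle₁ 0 2 (M₁.V.basicOpen_le _ hz))) hz htop)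
    · exact huaQ v hv ((mem_basicOpen_iff_of_pins hπ' ⟨(basicOpenStable (GModel.initial (p := p) (g₀ := g₀) hq h₀).act O hO (actO_symm_eq_of_fixed hG (GModel.initial (p := p) (g₀ := g₀) hq h₀) O (eI 1) (σI 1) (hactI 1) (hh 1) (hσh 1))).1, hWaff 1⟩ (hxJ 1 0) (hxJ 1 1) (le_of_eq (hOWeq 1 0)) (le_of_eq (hOWeq 1 1)) _ _ (hZ0pin 1 0) (hZ0pin 1 1) (M₁.V.basicOpen_le _ hz) (hUQW hv)).mp hz)
    · exact huaQ v hv hz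
    · exact huaQ v hv ((mem_basicOpen_iff_of_pins hπ' ⟨(basicOpenStable (GModel.initial (p := p) (g₀ := g₀) hq h₀).act O hO (actO_symm_eq_of_fixed hG (GModel.initial (p := p) (g₀ := g₀) hq h₀) O (eI 1) (σI 1) (hactI 1) (hh 1) (hσh 1))).1, hWaff 1⟩ (hxJ 1 2) (hxJ 1 1) (le_of_eq (hOWeq 1 2)) (le_of_eq (hOWeq 1 1)) _ _ (hZ0pin 1 2) (hZ0pin 1 1) (M₁.V.basicOpen_le _ hz) (hUQW hv)).mp hz)
  · rintro ⟨i', j'⟩ v hv hz; fin_cases i' <;> fin_cases j' <;> dsimp only at hz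
    · exact Scheme.mem_basicOpen_of_mul_eq_map hUQW hrf₁ hrelbQ hv (mem_basicOpen_appLE_top_of_pin_pow_of_not_mem_support π₁ ((infRees 𝒦).ideal D ^ (p * 18)) ⟨(basicOpenStable (GModel.initial (p := p) (g₀ := g₀) hq h₀).act O hO (actO_symm_eq_of_fixed hG (GModel.initial (p := p) (g₀ := g₀) hq h₀) O (eI 0) (σI 0) (hactI 0) (hh 0) (hσh 0))).1, hWaff 0⟩ ((eW 0).symm (y 0 0)) (hWO 0) (e₀.symm fO) (hnT 0) (le_of_eq (hOWeq 0 0)) (hWle₁ 0 0) _ (hZ1pin 0 0) (M₁.V.basicOpen_le _ hz) (hnotsupp 1 0 (by decide) v (hWle₁ 1 1 (hUQW hv)) (hWle₁ 0 0 (M₁.V.basicOpen_le _ hz))) hz htop)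
    · exact Scheme.mem_basicOpen_of_mul_eq_map hUQW hrf₁ hrelbQ hv (mem_basicOpen_appLE_top_of_pin_pow_of_not_mem_support π₁ ((infRees 𝒦).ideal D ^ (p * 18)) ⟨(basicOpenStable (GModel.initial (p := p) (g₀ := g₀) hq h₀).act O hO (actO_symm_eq_of_fixed hG (GModel.initial (p := p) (g₀ := g₀) hq h₀) O (eI 0) (σI 0) (hactI 0) (hh 0) (hσh 0))).1, hWaff 0⟩ ((eW 0).symm (y 0 1)) (hWO 0) (e₀.symm fO) (hnT 0) (le_of_eq (hOWeq 0 1)) (hWle₁ 0 1) _ (hZ1pin 0 1) (M₁.V.basicOpen_le _ hz) (hnotsupp 1 0 (by decide) v (hWle₁ 1 1 (hUQW hv)) (hWle₁ 0 1 (M₁.V.basicOpen_le _ hz))) hz htop)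
    · exact Scheme.mem_basicOpen_of_mul_eq_map hUQW hrf₁ hrelbQ hv (mem_basicOpen_appLE_top_of_pin_pow_of_not_mem_support π₁ ((infRees 𝒦).ideal D ^ (p * 18)) ⟨(basicOpenStable (GModel.initial (p := p) (g₀ := g₀) hq h₀).act O hO (actO_symm_eq_of_fixed hG (GModel.initial (p := p) (g₀ := g₀) hq h₀) O (eI 0) (σI 0) (hactI 0) (hh 0) (hσh 0))).1, hWaff 0⟩ ((eW 0).symm (y 0 2)) (hWO 0) (e₀.symm fO) (hnT 0) (le_of_eq (hOWeq 0 2)) (hWle₁ 0 2) _ (hZ1pin 0 2) (M₁.V.basicOpen_le _ hz) (hnotsupp 1 0 (by decide) v (hWle₁ 1 1 (hUQW hv)) (hWle₁ 0 2 (M₁.V.basicOpen_le _ hz))) hz htop)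
    · exact hubQ v hv ((mem_basicOpen_iff_of_pins hπ' ⟨(basicOpenStable (GModel.initial (p := p) (g₀ := g₀) hq h₀).act O hO (actO_symm_eq_of_fixed hG (GModel.initial (p := p) (g₀ := g₀) hq h₀) O (eI 1) (σI 1) (hactI 1) (hh 1) (hσh 1))).1, hWaff 1⟩ (hxJ 1 0) (hxJ 1 1) (le_of_eq (hOWeq 1 0)) (le_of_eq (hOWeq 1 1)) _ _ (hZ1pin 1 0) (hZ1pin 1 1) (M₁.V.basicOpen_le _ hz) (hUQW hv)).mp hz)
    · exact hubQ v hv hz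
    · exact hubQ v hv ((mem_basicOpen_iff_of_pins hπ' ⟨(basicOpenStable (GModel.initial (p := p) (g₀ := g₀) hq h₀).act O hO (actO_symm_eq_of_fixed hG (GModel.initial (p := p) (g₀ := g₀) hq h₀) O (eI 1) (σI 1) (hactI 1) (hh 1) (hσh 1))).1, hWaff 1⟩ (hxJ 1 2) (hxJ 1 1) (le_of_eq (hOWeq 1 2)) (le_of_eq (hOWeq 1 1)) _ _ (hZ1pin 1 2) (hZ1pin 1 1) (M₁.V.basicOpen_le _ hz) (hUQW hv)).mp hz)
  · rintro ⟨i', j'⟩ v hv hz; fin_cases i' <;> fin_cases j' <;> dsimp only at hz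
    · exact Scheme.mem_basicOpen_of_mul_eq_map hUQvW hrz₂ hrelaQv hv (mem_basicOpen_appLE_top_of_pin_pow_of_not_mem_support π₁ ((infRees 𝒦).ideal D ^ (p * 18)) ⟨(basicOpenStable (GModel.initial (p := p) (g₀ := g₀) hq h₀).act O hO (actO_symm_eq_of_fixed hG (GModel.initial (p := p) (g₀ := g₀) hq h₀) O (eI 0) (σI 0) (hactI 0) (hh 0) (hσh 0))).1, hWaff 0⟩ ((eW 0).symm (y 0 0)) (hWO 0) (e₀.symm (X 0)) (hn₀ 0) (le_of_eq (hOWeq 0 0)) (hWle₁ 0 0) _ (hZ0pin 0 0) (M₁.V.basicOpen_le _ hz) (hnotsupp 1 0 (by decide) v (hWle₁ 1 2 (hUQvW hv)) (hWle₁ 0 0 (M₁.V.basicOpen_le _ hz))) hz htop)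
    · exact Scheme.mem_basicOpen_of_mul_eq_map hUQvW hrz₂ hrelaQv hv (mem_basicOpen_appLE_top_of_pin_pow_of_not_mem_support π₁ ((infRees 𝒦).ideal D ^ (p * 18)) ⟨(basicOpenStable (GModel.initial (p := p) (g₀ := g₀) hq h₀).act O hO (actO_symm_eq_of_fixed hG (GModel.initial (p := p) (g₀ := g₀) hq h₀) O (eI 0) (σI 0) (hactI 0) (hh 0) (hσh 0))).1, hWaff 0⟩ ((eW 0).symm (y 0 1)) (hWO 0) (e₀.symm (X 0)) (hn₀ 0) (le_of_eq (hOWeq 0 1)) (hWle₁ 0 1) _ (hZ0pin 0 1) (M₁.V.basicOpen_le _ hz) (hnotsupp 1 0 (by decide) v (hWle₁ 1 2 (hUQvW hv)) (hWle₁ 0 1 (M₁.V.basicOpen_le _ hz))) hz htop)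
    · exact Scheme.mem_basicOpen_of_mul_eq_map hUQvW hrz₂ hrelaQv hv (mem_basicOpen_appLE_top_of_pin_pow_of_not_mem_support π₁ ((infRees 𝒦).ideal D ^ (p * 18)) ⟨(basicOpenStable (GModel.initial (p := p) (g₀ := g₀) hq h₀).act O hO (actO_symm_eq_of_fixed hG (GModel.initial (p := p) (g₀ := g₀) hq h₀) O (eI 0) (σI 0) (hactI 0) (hh 0) (hσh 0))).1, hWaff 0⟩ ((eW 0).symm (y 0 2)) (hWO 0) (e₀.symm (X 0)) (hn₀ 0) (le_of_eq (hOWeq 0 2)) (hWle₁ 0 2) _ (hZ0pin 0 2) (M₁.V.basicOpen_le _ hz) (hnotsupp 1 0 (by decide) v (hWle₁ 1 2 (hUQvW hv)) (hWle₁ 0 2 (M₁.V.basicOpen_le _ hz))) hz htop)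
    · exact huaQv v hv ((mem_basicOpen_iff_of_pins hπ' ⟨(basicOpenStable (GModel.initial (p := p) (g₀ := g₀) hq h₀).act O hO (actO_symm_eq_of_fixed hG (GModel.initial (p := p) (g₀ := g₀) hq h₀) O (eI 1) (σI 1) (hactI 1) (hh 1) (hσh 1))).1, hWaff 1⟩ (hxJ 1 0) (hxJ 1 2) (le_of_eq (hOWeq 1 0)) (le_of_eq (hOWeq 1 2)) _ _ (hZ0pin 1 0) (hZ0pin 1 2) (M₁.V.basicOpen_le _ hz) (hUQvW hv)).mp hz)
    · exact huaQv v hv ((mem_basicOpen_iff_of_pins hπ' ⟨(basicOpenStable (GModel.initial (p := p) (g₀ := g₀) hq h₀).act O hO (actO_symm_eq_of_fixed hG (GModel.initial (p := p) (g₀ := g₀) hq h₀) O (eI 1) (σI 1) (hactI 1) (hh 1) (hσh 1))).1, hWaff 1⟩ (hxJ 1 1) (hxJ 1 2) (le_of_eq (hOWeq 1 1)) (le_of_eq (hOWeq 1 2)) _ _ (hZ0pin 1 1) (hZ0pin 1 2) (M₁.V.basicOpen_le _ hz) (hUQvW hv)).mp hz)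
    · exact huaQv v hv hz
  · rintro ⟨i', j'⟩ v hv hz; fin_cases i' <;> fin_cases j' <;> dsimp only at hz
    · exact Scheme.mem_basicOpen_of_mul_eq_map hUQvW hrf₂ hrelbQv hv (mem_basicOpen_appLE_top_of_pin_pow_of_not_mem_support π₁ ((infRees 𝒦).ideal D ^ (p * 18)) ⟨(basicOpenStable (GModel.initial (p := p) (g₀ := g₀) hq h₀).act O hO (actO_symm_eq_of_fixed hG (GModel.initial (p := p) (g₀ := g₀) hq h₀) O (eI 0) (σI 0) (hactI 0) (hh 0) (hσh 0))).1, hWaff 0⟩ ((eW 0).symm (y 0 0)) (hWO 0) (e₀.symm fO) (hnT 0) (le_of_eq (hOWeq 0 0)) (hWle₁ 0 0) _ (hZ1pin 0 0) (M₁.V.basicOpen_le _ hz) (hnotsupp 1 0 (by decide) v (hWle₁ 1 2 (hUQvW hv)) (hWle₁ 0 0 (M₁.V.basicOpen_le _ hz))) hz htop)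
    · exact Scheme.mem_basicOpen_of_mul_eq_map hUQvW hrf₂ hrelbQv hv (mem_basicOpen_appLE_top_of_pin_pow_of_not_mem_support π₁ ((infRees 𝒦).ideal D ^ (p * 18)) ⟨(basicOpenStable (GModel.initial (p := p) (g₀ := g₀) hq h₀).act O hO (actO_symm_eq_of_fixed hG (GModel.initial (p := p) (g₀ := g₀) hq h₀) O (eI 0) (σI 0) (hactI 0) (hh 0) (hσh 0))).1, hWaff 0⟩ ((eW 0).symm (y 0 1)) (hWO 0) (e₀.symm fO) (hnT 0) (le_of_eq (hOWeq 0 1)) (hWle₁ 0 1) _ (hZ1pin 0 1) (M₁.V.basicOpen_le _ hz) (hnotsupp 1 0 (by decide) v (hWle₁ 1 2 (hUQvW hv)) (hWle₁ 0 1 (M₁.V.basicOpen_le _ hz))) hz htop)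
    · exact Scheme.mem_basicOpen_of_mul_eq_map hUQvW hrf₂ hrelbQv hv (mem_basicOpen_appLE_top_of_pin_pow_of_not_mem_support π₁ ((infRees 𝒦).ideal D ^ (p * 18)) ⟨(basicOpenStable (GModel.initial (p := p) (g₀ := g₀) hq h₀).act O hO (actO_symm_eq_of_fixed hG (GModel.initial (p := p) (g₀ := g₀) hq h₀) O (eI 0) (σI 0) (hactI 0) (hh 0) (hσh 0))).1, hWaff 0⟩ ((eW 0).symm (y 0 2)) (hWO 0) (e₀.symm fO) (hnT 0) (le_of_eq (hOWeq 0 2)) (hWle₁ 0 2) _ (hZ1pin 0 2) (M₁.V.basicOpen_le _ hz) (hnotsupp 1 0 (by decide) v (hWle₁ 1 2 (hUQvW hv)) (hWle₁ 0 2 (M₁.V.basicOpen_le _ hz))) hz htop)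
    · exact hubQv v hv ((mem_basicOpen_iff_of_pins hπ' ⟨(basicOpenStable (GModel.initial (p := p) (g₀ := g₀) hq h₀).act O hO (actO_symm_eq_of_fixed hG (GModel.initial (p := p) (g₀ := g₀) hq h₀) O (eI 1) (σI 1) (hactI 1) (hh 1) (hσh 1))).1, hWaff 1⟩ (hxJ 1 0) (hxJ 1 2) (le_of_eq (hOWeq 1 0)) (le_of_eq (hOWeq 1 2)) _ _ (hZ1pin 1 0) (hZ1pin 1 2) (M₁.V.basicOpen_le _ hz) (hUQvW hv)).mp hz)
    · exact hubQv v hv ((mem_basicOpen_iff_of_pins hπ' ⟨(basicOpenStable (GModel.initial (p := p) (g₀ := g₀) hq h₀).act O hO (actO_symm_eq_of_fixed hG (GModel.initial (p := p) (g₀ := g₀) hq h₀) O (eI 1) (σI 1) (hactI 1) (hh 1) (hσh 1))).1, hWaff 1⟩ (hxJ 1 1) (hxJ 1 2) (le_of_eq (hOWeq 1 1)) (le_of_eq (hOWeq 1 2)) _ _ (hZ1pin 1 1) (hZ1pin 1 2) (M₁.V.basicOpen_le _ hz) (hUQvW hv)).mp hz)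
    · exact hubQv v hv hz
  · intro v hv; rcases hF₁ hv with hold | hnew
    · exact absurd (Set.mem_iUnion.mp (hF₀ hold.1)) (fun h => hold.2 (Set.mem_iUnion.mpr h))
    · obtain ⟨i, hi⟩ := Set.mem_iUnion.mp hnew; obtain ⟨j, hvW, hvR⟩ := Set.mem_iUnion.mp hi; rcases hresid i j v hvW (hvR 0) (hvR 1) with h | h | h
      · exact Or.inl (Or.inl h)
      · exact Or.inl (Or.inr h)
      · exact Or.inr h
end Summit.ResolutionOfSingularities.ResolutionOfSingularities.Theorems.WildQuotientResolution.S1.GameFrame.GModel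

end
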